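import Literature.Topology.FourManifolds.SimplifiedBrokenLefschetzMorseCharts
import Literature.Topology.FourManifolds.RegularLevelMorseData
import Literature.Topology.FourManifolds.MorseLemma
import Literature.Topology.FourManifolds.MorseProofs
import Literature.Topology.FourManifolds.MorseExistence
import Literature.Topology.FourManifolds.SphereMorseCount
import Literature.Topology.FourManifolds.SPC4HandleChainProofs
import Literature.Geometry.Manifold.ProperSubmersionLocalTrivialisationTranslate
import Literature.Geometry.Manifold.SmoothEmbeddingInverse
import Mathlib.Analysis.Calculus.BumpFunction.FiniteDimension
import Mathlib.Analysis.InnerProductSpace.PiL2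
import HarnessLib

/-!
# Morse perturbation of `ℓ ∘ f` near a regular fibre over a nondegenerate critical point of `ℓ`

Topic `Literature/Topology/FourManifolds`; groundwork for the Euler count
`card_eq_four_mul_of_sblf_of_homotopyEquiv_sphere_four` (Baykur 2012, Lemma 7) of
`SimplifiedBrokenLefschetzFibration.lean`, in the Morse-theoretic reading that counts the
critical points of ONE global Morse function on the closed total space.  Everything here is
**proved**; there are no definitions and no named facts.

Let `f : X → B` be a `C^∞` map from a closed 4-manifold to a surface, `y₀ ∈ B` a point over
which `f` is submersive (on a neighbourhood `O` of `y₀`), and `ℓ : B → ℝ` a `C^∞` function with a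
nondegenerate critical point at `y₀`.  The composite `g = ℓ ∘ f` is critical along the whole
fibre `F₀ = f⁻¹(y₀)` (a Morse–Bott situation).  The classical remedy (Milnor 1963, §2–§3 with
Ehresmann's local triviality `f⁻¹(V) ≅ V × F₀`, Bröcker–Jänich 1982, (8.12)): in the product
coordinates `(u, s)` put `g̃ = ℓ(u) + ε χ(u) μ(s)` with `μ` a Morse function on the closed
surface `F₀`, `χ` a bump function at `u = 0` and `ε > 0` small.  Then `g̃` is `C^∞`, agrees with
`g` off `f⁻¹(K)` for a compact `K ⊆ O` containing `y₀`, its critical points over `K` are exactly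
the points `(0, s)` with `s` critical for `μ`, each nondegenerate of index
`ind_{y₀} ℓ + ind_s μ` (the Hessian is the block sum), so that their signed count is
`(-1)^{ind ℓ} Σ_s (-1)^{ind μ} = (-1)^{ind ℓ} χ(F₀)` (Milnor 1963, Thm. 5.2 / Morse equality on
the closed surface, the tree's `SphereMorseCount.morseCount_eq_relEuler`).

Main statement: `exists_morsePerturbation_near_regularFibre`.

## References

* J. Milnor, *Morse theory* (1963), §2, §3, Thm. 5.2. [Milnor1963]
* T. Bröcker, K. Jänich, *Introduction to Differential Topology* (1982), (8.12). [BrockerJanichIDT1982]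
* R. İ. Baykur, *Broken Lefschetz fibrations and smooth structures on 4-manifolds*, Geom. Topol.
  Monogr. 18 (2012), Lemma 7. [Baykur2012]
-/

noncomputable section

open scoped Manifold ContDiff Topology
open Set Function Filter

namespace Literature.Topology.FourManifolds

/-! ### Block sums of bilinear forms read through a linear isomorphism -/

section BlockForm

variable {E₁ E₂ F : Type*} [AddCommGroup E₁] [Module ℝ E₁] [FiniteDimensional ℝ E₁]
  [AddCommGroup E₂] [Module ℝ E₂] [FiniteDimensional ℝ E₂] [AddCommGroup F] [Module ℝ F]

/-- **Index of a block sum.**  If `B (v, w) = B₁ (v₁, w₁) + c B₂ (v₂, w₂)` in the coordinates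
`L v = (v₁, v₂)` of a linear isomorphism `L : F ≃ E₁ × E₂`, with `B₁, B₂` symmetric and `c > 0`,
then `ind⁻ B = ind⁻ B₁ + ind⁻ B₂` (Sylvester; Serre, Ch. V §1.3.7 for the orthogonal sum).
[cite: Milnor1963, §2] -/
theorem sigNeg_eq_add_of_forall_apply_eq_blockSum {B : LinearMap.BilinForm ℝ F}
    {B₁ : LinearMap.BilinForm ℝ E₁} {B₂ : LinearMap.BilinForm ℝ E₂} (L : F ≃ₗ[ℝ] E₁ × E₂) {c : ℝ}
    (hc : 0 < c) (h₁ : B₁.IsSymm) (h₂ : B₂.IsSymm)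
    (h : ∀ v w, B v w = B₁ (L v).1 (L w).1 + c * B₂ (L v).2 (L w).2) :
    sigNeg B.toQuadraticMap = sigNeg B₁.toQuadraticMap + sigNeg B₂.toQuadraticMap := by
  have hB : ∀ v w, B v w = (B₁.prod (c • B₂)) (L v) (L w) := fun v w => by
    rw [LinearMap.BilinForm.prod_apply, h v w, LinearMap.smul_apply, LinearMap.smul_apply,
      smul_eq_mul]
  have h₂' : (c • B₂).IsSymm := ⟨fun x y => by
    simp only [LinearMap.smul_apply, smul_eq_mul, h₂.eq x y]⟩
  rw [sigNeg_eq_of_forall_apply_eq L hB, LinearMap.BilinForm.sigNeg_prod B₁ (c • B₂) h₁ h₂']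
  have hQ : (c • B₂).toQuadraticMap = c • B₂.toQuadraticMap := by
    ext x
    simp only [LinearMap.BilinMap.toQuadraticMap_apply, LinearMap.smul_apply,
      QuadraticMap.smul_apply]
  rw [hQ, sigNeg_smul_of_pos _ hc]

omit [FiniteDimensional ℝ E₁] [FiniteDimensional ℝ E₂] in
/-- **Nondegeneracy of a block sum.**  With `B`, `B₁`, `B₂`, `L` as in
`sigNeg_eq_add_of_forall_apply_eq_blockSum` and `c ≠ 0`: if `B₁` and `B₂` are nondegenerate then
so is `B`. [cite: Milnor1963, §2] -/
theorem nondegenerate_of_forall_apply_eq_blockSum {B : LinearMap.BilinForm ℝ F}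
    {B₁ : LinearMap.BilinForm ℝ E₁} {B₂ : LinearMap.BilinForm ℝ E₂} (L : F ≃ₗ[ℝ] E₁ × E₂) {c : ℝ}
    (hc : c ≠ 0) (h₁ : B₁.Nondegenerate) (h₂ : B₂.Nondegenerate)
    (h : ∀ v w, B v w = B₁ (L v).1 (L w).1 + c * B₂ (L v).2 (L w).2) : B.Nondegenerate := by
  have key : ∀ v : F, (L v).1 = 0 → (L v).2 = 0 → v = 0 := fun v e1 e2 => by
    have hLv : L v = 0 := Prod.ext e1 e2
    simpa using congrArg L.symm hLv
  constructor
  · intro v hv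
    refine key v (h₁.1 _ fun y => ?_) (h₂.1 _ fun y => ?_)
    · have := hv (L.symm (y, 0))
      simpa [h] using this
    · have := hv (L.symm (0, y))
      simpa [h, hc] using this
  · intro w hw
    refine key w (h₁.2 _ fun x => ?_) (h₂.2 _ fun x => ?_)
    · have := hw (L.symm (x, 0))
      simpa [h] using this
    · have := hw (L.symm (0, x))
      simpa [h, hc] using this

end BlockForm

/-! ### Model calculus: `G (u, v) = λ u + ε χ u μ v` read through `J : F ≃ E₁ × E₂` -/

section ModelCalculus

variable {F E₁ E₂ : Type*} [NormedAddCommGroup F] [NormedSpace ℝ F]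
  [NormedAddCommGroup E₁] [NormedSpace ℝ E₁] [NormedAddCommGroup E₂] [NormedSpace ℝ E₂]

/-- A linear form `A ∘ pr₁ ∘ J + B ∘ pr₂ ∘ J` vanishes iff both `A` and `B` do. [folklore] -/
theorem comp_fst_add_comp_snd_eq_zero_iff (J : F ≃L[ℝ] E₁ × E₂) (A : E₁ →L[ℝ] ℝ)
    (B : E₂ →L[ℝ] ℝ) :
    A.comp ((ContinuousLinearMap.fst ℝ E₁ E₂).comp (J : F →L[ℝ] E₁ × E₂)) +
        B.comp ((ContinuousLinearMap.snd ℝ E₁ E₂).comp (J : F →L[ℝ] E₁ × E₂)) = 0 ↔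
      A = 0 ∧ B = 0 := by
  constructor
  · intro hAB
    have happ : ∀ v : F, A (J v).1 + B (J v).2 = 0 := fun v => by
      simpa using DFunLike.congr_fun hAB v
    constructor
    · ext x
      simpa using happ (J.symm (x, 0))
    · ext y
      simpa using happ (J.symm (0, y))
  · rintro ⟨rfl, rfl⟩
    simp

/-- **First derivative of the model function** `G w = λ (J w)₁ + ε χ (J w)₁ μ (J w)₂`.
[folklore] -/
theorem hasFDerivAt_blockModel (J : F ≃L[ℝ] E₁ × E₂) {lam χ : E₁ → ℝ} {μ : E₂ → ℝ} (ε : ℝ)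
    {w : F} {l' χ' : E₁ →L[ℝ] ℝ} {μ' : E₂ →L[ℝ] ℝ}
    (hl : HasFDerivAt lam l' (J w).1) (hχ : HasFDerivAt χ χ' (J w).1)
    (hμ : HasFDerivAt μ μ' (J w).2) :
    HasFDerivAt (fun w => lam (J w).1 + ε * (χ (J w).1 * μ (J w).2))
      ((l' + (ε * μ (J w).2) • χ').comp
          ((ContinuousLinearMap.fst ℝ E₁ E₂).comp (J : F →L[ℝ] E₁ × E₂)) +
        ((ε * χ (J w).1) • μ').comp
          ((ContinuousLinearMap.snd ℝ E₁ E₂).comp (J : F →L[ℝ] E₁ × E₂))) w := by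
  have hJ : HasFDerivAt (fun w : F => J w) (J : F →L[ℝ] E₁ × E₂) w := J.hasFDerivAt
  have h1 : HasFDerivAt (fun w : F => (J w).1)
      ((ContinuousLinearMap.fst ℝ E₁ E₂).comp (J : F →L[ℝ] E₁ × E₂)) w := hasFDerivAt_fst.comp w hJ
  have h2 : HasFDerivAt (fun w : F => (J w).2)
      ((ContinuousLinearMap.snd ℝ E₁ E₂).comp (J : F →L[ℝ] E₁ × E₂)) w := hasFDerivAt_snd.comp w hJ
  have hA := hl.comp w h1
  have hB := hχ.comp w h1
  have hC := hμ.comp w h2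
  have hBC := hB.mul hC
  have h := hA.add (hBC.const_mul ε)
  refine h.congr_fderiv ?_
  ext z
  simp only [add_apply, ContinuousLinearMap.comp_apply,
    FunLike.coe_smul, Pi.smul_apply, ContinuousLinearMap.coe_fst',
    ContinuousLinearMap.coe_snd', ContinuousLinearEquiv.coe_coe, smul_eq_mul, Function.comp_apply]
  ring

/-- **Criticality of the model function**: `DG_w = 0` iff
`Dλ + ε μ Dχ = 0` at `(J w)₁` and `ε χ Dμ = 0` at `(J w)₂`. [folklore] -/
theorem fderiv_blockModel_eq_zero_iff (J : F ≃L[ℝ] E₁ × E₂) {lam χ : E₁ → ℝ} {μ : E₂ → ℝ}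
    (ε : ℝ) {w : F} (hl : DifferentiableAt ℝ lam (J w).1) (hχ : DifferentiableAt ℝ χ (J w).1)
    (hμ : DifferentiableAt ℝ μ (J w).2) :
    fderiv ℝ (fun w => lam (J w).1 + ε * (χ (J w).1 * μ (J w).2)) w = 0 ↔
      fderiv ℝ lam (J w).1 + (ε * μ (J w).2) • fderiv ℝ χ (J w).1 = 0 ∧
        (ε * χ (J w).1) • fderiv ℝ μ (J w).2 = 0 := by
  rw [(hasFDerivAt_blockModel J ε hl.hasFDerivAt hχ.hasFDerivAt hμ.hasFDerivAt).fderiv,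
    comp_fst_add_comp_snd_eq_zero_iff]

/-- **The Hessian of the model function where the bump is `≡ 1`**: if `χ = 1` near `(J w₀)₁`
then `D²G_{w₀} (a, b) = D²λ ((J a)₁, (J b)₁) + ε D²μ ((J a)₂, (J b)₂)` (block form).
[cite: Milnor1963, §2] -/
theorem fderiv_fderiv_blockModel_apply (J : F ≃L[ℝ] E₁ × E₂) {lam χ : E₁ → ℝ} {μ : E₂ → ℝ}
    (ε : ℝ) {w₀ : F} (hl : ContDiffAt ℝ 2 lam (J w₀).1)
    (hχ : χ =ᶠ[𝓝 (J w₀).1] fun _ => 1) (hμ : ContDiffAt ℝ 2 μ (J w₀).2) (a b : F) :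
    fderiv ℝ (fderiv ℝ (fun w => lam (J w).1 + ε * (χ (J w).1 * μ (J w).2))) w₀ a b =
      fderiv ℝ (fderiv ℝ lam) (J w₀).1 (J a).1 (J b).1 +
        ε * fderiv ℝ (fderiv ℝ μ) (J w₀).2 (J a).2 (J b).2 := by
  set P₁ : F →L[ℝ] E₁ := (ContinuousLinearMap.fst ℝ E₁ E₂).comp (J : F →L[ℝ] E₁ × E₂) with hP₁
  set P₂ : F →L[ℝ] E₂ := (ContinuousLinearMap.snd ℝ E₁ E₂).comp (J : F →L[ℝ] E₁ × E₂) with hP₂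
  have hP₁w : ∀ w, P₁ w = (J w).1 := fun w => rfl
  have hP₂w : ∀ w, P₂ w = (J w).2 := fun w => rfl
  -- near `w₀` the model function is `λ ∘ P₁ + ε • (μ ∘ P₂)`
  have hev : (fun w => lam (J w).1 + ε * (χ (J w).1 * μ (J w).2)) =ᶠ[𝓝 w₀]
      (lam ∘ P₁) + ε • (μ ∘ P₂) := by
    have hc : ContinuousAt (fun w : F => (J w).1) w₀ := (P₁.continuous.continuousAt)
    filter_upwards [hc.preimage_mem_nhds hχ] with w hw
    have hw' : χ (J w).1 = 1 := by simpa using hw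
    simp only [Pi.add_apply, Pi.smul_apply, Function.comp_apply, hP₁w, hP₂w, hw', one_mul,
      smul_eq_mul]
  rw [(hev.fderiv).fderiv_eq]
  -- differentiability of the two summands near `w₀`
  have hA2 : ContDiffAt ℝ 2 (lam ∘ P₁) w₀ := hl.comp w₀ P₁.contDiff.contDiffAt
  have hC2 : ContDiffAt ℝ 2 (μ ∘ P₂) w₀ := hμ.comp w₀ P₂.contDiff.contDiffAt
  have hAev : ∀ᶠ w in 𝓝 w₀, DifferentiableAt ℝ (lam ∘ P₁) w := by
    filter_upwards [hA2.eventually (by simp)] with w hw using hw.differentiableAt (by simp)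
  have hCev : ∀ᶠ w in 𝓝 w₀, DifferentiableAt ℝ (μ ∘ P₂) w := by
    filter_upwards [hC2.eventually (by simp)] with w hw using hw.differentiableAt (by simp)
  have hsum : fderiv ℝ ((lam ∘ P₁) + ε • (μ ∘ P₂)) =ᶠ[𝓝 w₀]
      fderiv ℝ (lam ∘ P₁) + ε • fderiv ℝ (μ ∘ P₂) := by
    filter_upwards [hAev, hCev] with w hwA hwC
    rw [Pi.add_apply, Pi.smul_apply, fderiv_add hwA (hwC.const_smul ε), fderiv_const_smul hwC]
  rw [hsum.fderiv_eq]
  have hdA : DifferentiableAt ℝ (fderiv ℝ (lam ∘ P₁)) w₀ :=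
    (hA2.fderiv_right (m := 1) (by norm_cast)).differentiableAt (by simp)
  have hdC : DifferentiableAt ℝ (fderiv ℝ (μ ∘ P₂)) w₀ :=
    (hC2.fderiv_right (m := 1) (by norm_cast)).differentiableAt (by simp)
  rw [fderiv_add hdA (hdC.const_smul ε), fderiv_const_smul hdC]
  simp only [add_apply, FunLike.coe_smul, Pi.smul_apply,
    smul_eq_mul]
  rw [fderiv_fderiv_comp_clm_apply P₁ (by simpa [hP₁w] using hl),
    fderiv_fderiv_comp_clm_apply P₂ (by simpa [hP₂w] using hμ)]
  rfl

end ModelCalculus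

/-! ### Morse data read in a smooth `ℝⁿ⁺¹`-valued local diffeomorphism -/

section ChartTransfer

variable {n : ℕ} {M : Type*} [TopologicalSpace M] [ChartedSpace (EuclideanSpace ℝ (Fin (n + 1))) M]
  [IsManifold (𝓡 (n + 1)) ∞ M]

/-- **Morse data read in any smooth local coordinate system.**  Let `Θ` be a local
diffeomorphism of `M` onto an open subset of the model space `ℝⁿ⁺¹` (an open partial
homeomorphism, `C^∞` with `C^∞` inverse), `q ∈ Θ.source`, and suppose that near `Θ q` the
function `f ∘ Θ⁻¹` agrees with a function `G` of class `C²` at `Θ q`.  Then `q` is a critical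
point of `f` iff `DG(Θ q) = 0`, and in that case the Hessian of `f` at `q` is nondegenerate
iff the Hessian `D²G(Θ q)` is, and the Morse indices agree (Milnor 1963, §2: criticality,
nondegeneracy and index do not depend on the coordinate system). [cite: Milnor1963, §2] -/
theorem morseData_of_localRepresentative {f : M → ℝ} {Θ : OpenPartialHomeomorph M (EuclideanSpace ℝ (Fin (n + 1)))}
    (hΘ : ContMDiffOn (𝓡 (n + 1)) (𝓡 (n + 1)) ∞ Θ Θ.source)
    (hΘ' : ContMDiffOn (𝓡 (n + 1)) (𝓡 (n + 1)) ∞ Θ.symm Θ.target) {q : M} (hq : q ∈ Θ.source)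
    {G : EuclideanSpace ℝ (Fin (n + 1)) → ℝ} (hG : ContDiffAt ℝ 2 G (Θ q)) (hfG : f ∘ Θ.symm =ᶠ[𝓝 (Θ q)] G) :
    (IsMCriticalPt (𝓡 (n + 1)) f q ↔ fderiv ℝ G (Θ q) = 0) ∧
    (IsMCriticalPt (𝓡 (n + 1)) f q →
      ((mhessian (𝓡 (n + 1)) f q).Nondegenerate ↔
          (mhessian (𝓡 (n + 1)) G (Θ q)).Nondegenerate) ∧
        morseIndex (𝓡 (n + 1)) f q = morseIndex (𝓡 (n + 1)) G (Θ q)) := by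
  -- `Θ` is a chart of the maximal atlas
  have he : Θ ∈ IsManifold.maximalAtlas (𝓡 (n + 1)) ∞ M :=
    (IsManifold.mem_maximalAtlas_iff_contMDiffOn Θ).2 ⟨hΘ, hΘ'⟩
  have he2 : Θ ∈ IsManifold.maximalAtlas (𝓡 (n + 1)) 2 M :=
    IsManifold.maximalAtlas_subset_of_le (by norm_cast) he
  -- `f = G ∘ Θ` near `q`, so `f` is `C²` at `q`
  have hΘq : ContMDiffAt (𝓡 (n + 1)) (𝓡 (n + 1)) ∞ Θ q :=
    (hΘ q hq).contMDiffAt (Θ.open_source.mem_nhds hq)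
  have hfev : f =ᶠ[𝓝 q] G ∘ Θ := by
    have h1 : ∀ᶠ y in 𝓝 q, y ∈ Θ.source := Θ.open_source.mem_nhds hq
    have h2 : ∀ᶠ y in 𝓝 q, (f ∘ Θ.symm) (Θ y) = G (Θ y) :=
      hΘq.continuousAt.eventually hfG
    filter_upwards [h1, h2] with y hy hy'
    simpa [Θ.left_inv hy] using hy'
  have hf2 : ContMDiffAt (𝓡 (n + 1)) 𝓘(ℝ, ℝ) 2 f q := by
    refine ContMDiffAt.congr_of_eventuallyEq ?_ hfev
    exact hG.contMDiffAt.comp q (hΘq.of_le (by norm_cast))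
  have hmd : MDifferentiableAt (𝓡 (n + 1)) 𝓘(ℝ, ℝ) f q := hf2.mdifferentiableAt (by norm_cast)
  -- criticality
  have hcrit : IsMCriticalPt (𝓡 (n + 1)) f q ↔ fderiv ℝ G (Θ q) = 0 := by
    rw [isMCriticalPt_iff_fderiv_comp_symm_eq_zero (I := 𝓡 (n + 1)) hΘ hΘ' hq hmd, hfG.fderiv_eq]
  refine ⟨hcrit, fun hc => ?_⟩
  -- the chart Hessian is the model Hessian of `G`
  have hB : hessianInChart (𝓡 (n + 1)) Θ f q = mhessian (𝓡 (n + 1)) G (Θ q) := by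
    refine LinearMap.ext fun v => LinearMap.ext fun w => ?_
    rw [RegularLevel.hessianInChart_apply_eq, MorseBirth.mhessian_model_apply,
      (hfG.fderiv).fderiv_eq]
  constructor
  · rw [nondegenerate_mhessian_iff hf2 hc he2 hq, hB]
  · rw [morseIndex_eq_sigNeg_hessianInChart hf2 hc he2 hq, hB]; rfl

/-- **Criticality read in any smooth local coordinate system** (the first clause of
`morseData_of_localRepresentative`, with `G = f ∘ Θ⁻¹` itself): `q` is critical for `f` iff the
derivative of `f ∘ Θ⁻¹` vanishes at `Θ q`. [cite: Milnor1963, §2] -/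
theorem isMCriticalPt_iff_fderiv_comp_symm_eq_zero' {f : M → ℝ}
    {Θ : OpenPartialHomeomorph M (EuclideanSpace ℝ (Fin (n + 1)))}
    (hΘ : ContMDiffOn (𝓡 (n + 1)) (𝓡 (n + 1)) ∞ Θ Θ.source)
    (hΘ' : ContMDiffOn (𝓡 (n + 1)) (𝓡 (n + 1)) ∞ Θ.symm Θ.target) {q : M} (hq : q ∈ Θ.source)
    (hG : ContDiffAt ℝ 2 (f ∘ Θ.symm) (Θ q)) :
    IsMCriticalPt (𝓡 (n + 1)) f q ↔ fderiv ℝ (f ∘ Θ.symm) (Θ q) = 0 :=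
  (morseData_of_localRepresentative hΘ hΘ' hq hG EventuallyEq.rfl).1

end ChartTransfer

/-! ### Germ invariance of the Morse data -/

section Germ

variable {E H : Type*} [NormedAddCommGroup E] [NormedSpace ℝ E] [TopologicalSpace H]
  {I : ModelWithCorners ℝ E H} {M : Type*} [TopologicalSpace M] [ChartedSpace H M]

/-- Functions that agree near `x` have the same Hessian at `x`. [folklore] -/
theorem mhessian_congr_of_eventuallyEq {f g : M → ℝ} {x : M} (h : g =ᶠ[𝓝 x] f) :
    mhessian I g x = mhessian I f x :=
  mhessian_congr_of_eventuallyEq_add_const (c := 0) (h.trans (by simp))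

/-- Functions that agree near `x` have the same criticality, nondegeneracy and Morse index at
`x` (all three are read on the germ). [folklore] -/
theorem morseData_congr_of_eventuallyEq {f g : M → ℝ} {x : M} (h : g =ᶠ[𝓝 x] f) :
    (IsMCriticalPt I g x ↔ IsMCriticalPt I f x) ∧
      ((mhessian I g x).Nondegenerate ↔ (mhessian I f x).Nondegenerate) ∧
        morseIndex I g x = morseIndex I f x := by
  refine ⟨isMCriticalPt_congr_of_eventuallyEq_add_const (c := 0) (h.trans (by simp)), ?_, ?_⟩
  · rw [mhessian_congr_of_eventuallyEq h]
  · unfold morseIndex; rw [mhessian_congr_of_eventuallyEq h]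

end Germ

/-! ### A point where `df = 0` is critical for every composite -/

section Submersion

variable {E H : Type*} [NormedAddCommGroup E] [NormedSpace ℝ E] [TopologicalSpace H]
  {I : ModelWithCorners ℝ E H} {M : Type*} [TopologicalSpace M] [ChartedSpace H M]
  {E' H' : Type*} [NormedAddCommGroup E'] [NormedSpace ℝ E'] [TopologicalSpace H']
  {J : ModelWithCorners ℝ E' H'} {N : Type*} [TopologicalSpace N] [ChartedSpace H' N]

/-- If `df_q = 0` then `q` is a critical point of every composite `ℓ ∘ f` (e.g. a Lefschetz
critical point of a fibration is critical for every height function composed with it; chain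
rule, Milnor 1963, §2). [cite: Milnor1963, §2] -/
theorem isMCriticalPt_comp_of_mfderiv_eq_zero {f : M → N} {ℓ : N → ℝ} {q : M}
    (hf : MDifferentiableAt I J f q) (hℓ : MDifferentiableAt J 𝓘(ℝ, ℝ) ℓ (f q))
    (h0 : mfderiv I J f q = 0) : IsMCriticalPt I (ℓ ∘ f) q := by
  unfold IsMCriticalPt
  rw [mfderiv_comp q hℓ hf, h0, ContinuousLinearMap.comp_zero]
  rfl

end Submersion


/-! ### Local product structure of a proper submersion near a fibre, with a base chart -/

section LocalProduct

variable {X : Type*} [TopologicalSpace X] [ChartedSpace (EuclideanSpace ℝ (Fin 4)) X]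
  {B : Type*} [TopologicalSpace B] [ChartedSpace (EuclideanSpace ℝ (Fin 2)) B]

/-- **Local product data of `f : X⁴ → B²` near the fibre over `y₀`** (Ehresmann's local
triviality in the translation form of the tree's
`Literature.Geometry.Manifold.exists_localTrivialisation_translate`, Bröcker–Jänich 1982,
(8.12), with the base coordinate made a global chart `τ : V ≅ ℝ²` with inverse `β`): an open
`V ∋ y₀`, a `C^∞` coordinate `τ` on `V`, injective with `τ y₀ = 0` and `C^∞` inverse
`β : ℝ² → V`, and jointly `C^∞`, mutually inverse, tube-preserving translations
`Tr, Sr : ℝ² × f⁻¹(V) → f⁻¹(V)` with `Tr (0, ·) = id` and the translation law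
`τ (f (Tr (u, y))) = τ (f y) + u`. [cite: BrockerJanichIDT1982, (8.12)] -/
structure IsLocalProductNear (f : X → B) (y₀ : B) (V : Set B) (τ : B → EuclideanSpace ℝ (Fin 2))
    (β : EuclideanSpace ℝ (Fin 2) → B) (Tr Sr : EuclideanSpace ℝ (Fin 2) × X → X) : Prop where
  isOpen : IsOpen V
  mem : y₀ ∈ V
  contMDiffOn_τ : ContMDiffOn (𝓡 2) (𝓡 2) ∞ τ V
  τ_apply : τ y₀ = 0
  β_τ : ∀ y ∈ V, β (τ y) = y
  τ_β : ∀ u, τ (β u) = u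
  β_mem : ∀ u, β u ∈ V
  contMDiff_β : ContMDiff (𝓡 2) (𝓡 2) ∞ β
  contMDiffOn_Tr : ContMDiffOn ((𝓡 2).prod (𝓡 4)) (𝓡 4) ∞ Tr (univ ×ˢ (f ⁻¹' V))
  contMDiffOn_Sr : ContMDiffOn ((𝓡 2).prod (𝓡 4)) (𝓡 4) ∞ Sr (univ ×ˢ (f ⁻¹' V))
  Tr_mem : ∀ u, ∀ y ∈ f ⁻¹' V, Tr (u, y) ∈ f ⁻¹' V
  Sr_mem : ∀ u, ∀ y ∈ f ⁻¹' V, Sr (u, y) ∈ f ⁻¹' V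
  Sr_Tr : ∀ u, ∀ y ∈ f ⁻¹' V, Sr (u, Tr (u, y)) = y
  Tr_Sr : ∀ u, ∀ y ∈ f ⁻¹' V, Tr (u, Sr (u, y)) = y
  Tr_zero : ∀ y ∈ f ⁻¹' V, Tr (0, y) = y
  τ_Tr : ∀ u, ∀ y ∈ f ⁻¹' V, τ (f (Tr (u, y))) = τ (f y) + u

/-- **Existence of local product data** near a non-empty fibre `f⁻¹(y₀)` of a `C^∞` map
`f : X → B` from a closed 4-manifold to a surface that is submersive over an open `O ∋ y₀`
(Ehresmann; the tree's `exists_localTrivialisation_translate`, its base coordinate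
`V → ℝ^{dim}` identified with `ℝ²` and inverted along the section `u ↦ f (Tr (u, x₀))`).
[cite: BrockerJanichIDT1982, (8.12)] -/
theorem exists_isLocalProductNear [T2Space X] [SecondCountableTopology X] [CompactSpace X]
    [IsManifold (𝓡 4) ∞ X] [T2Space B] [IsManifold (𝓡 2) ∞ B] {f : X → B}
    (hf : ContMDiff (𝓡 4) (𝓡 2) ∞ f) {y₀ : B} {O : Set B} (hO : IsOpen O) (hy₀ : y₀ ∈ O)
    (hsub : ∀ x, f x ∈ O → Surjective (mfderiv (𝓡 4) (𝓡 2) f x)) {x₀ : X} (hx₀ : f x₀ = y₀) :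
    ∃ V τ β Tr Sr, IsLocalProductNear f y₀ V τ β Tr Sr ∧ V ⊆ O := by
  obtain ⟨V, W, τ, Tr, Sr, hVo, hy₀V, hVO, -, hW, hτs, hτinj, hτ0, hTrs, hSrs, hTrW, hSrW, hSrTr,
    hTrSr, hTr0, htrans⟩ :=
    Literature.Geometry.Manifold.exists_localTrivialisation_translate (IT := 𝓡 4)
      (EB := EuclideanSpace ℝ (Fin 2)) hf hO hy₀ hsub
      (fun K _ hK => hK.preimage_continuous hf.continuous)
  subst hW
  -- identify `ℝ^{dim ℝ²}` with `ℝ²`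
  let ι : EuclideanSpace ℝ (Fin (Module.finrank ℝ (EuclideanSpace ℝ (Fin 2)))) ≃L[ℝ]
      EuclideanSpace ℝ (Fin 2) :=
    ContinuousLinearEquiv.ofFinrankEq (by rw [finrank_euclideanSpace_fin])
  have hιs : ContMDiff (𝓡 (Module.finrank ℝ (EuclideanSpace ℝ (Fin 2)))) (𝓡 2) ∞ ι :=
    ι.contDiff.contMDiff
  have hιs' : ContMDiff (𝓡 2) (𝓡 (Module.finrank ℝ (EuclideanSpace ℝ (Fin 2)))) ∞ ι.symm :=
    ι.symm.contDiff.contMDiff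
  have hx₀W : x₀ ∈ f ⁻¹' V := by simpa [hx₀] using hy₀V
  -- the new data
  let τ' : B → EuclideanSpace ℝ (Fin 2) := fun y => ι (τ y)
  let Tr' : EuclideanSpace ℝ (Fin 2) × X → X := fun p => Tr (ι.symm p.1, p.2)
  let Sr' : EuclideanSpace ℝ (Fin 2) × X → X := fun p => Sr (ι.symm p.1, p.2)
  let β : EuclideanSpace ℝ (Fin 2) → B := fun u => f (Tr (ι.symm u, x₀))
  have hPs : ContMDiff ((𝓡 2).prod (𝓡 4))
      ((𝓡 (Module.finrank ℝ (EuclideanSpace ℝ (Fin 2)))).prod (𝓡 4)) ∞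
      (fun p : EuclideanSpace ℝ (Fin 2) × X => (ι.symm p.1, p.2)) :=
    hιs'.prodMap contMDiff_id
  have hPmaps : MapsTo (fun p : EuclideanSpace ℝ (Fin 2) × X => (ι.symm p.1, p.2))
      (univ ×ˢ (f ⁻¹' V)) (univ ×ˢ (f ⁻¹' V)) := fun p hp => ⟨mem_univ _, hp.2⟩
  have hτβ : ∀ u, τ' (β u) = u := fun u => by
    simp only [τ', β]
    rw [htrans _ _ hx₀W, hx₀, hτ0, zero_add, ContinuousLinearEquiv.apply_symm_apply]
  have hβV : ∀ u, β u ∈ V := fun u => hTrW _ _ hx₀W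
  refine ⟨V, τ', β, Tr', Sr', ⟨hVo, hy₀V, ?_, ?_, ?_, hτβ, hβV, ?_, ?_, ?_, ?_, ?_, ?_, ?_, ?_, ?_⟩,
    hVO⟩
  · exact hιs.comp_contMDiffOn hτs
  · simp only [τ']
    rw [hτ0, map_zero]
  · intro y hy
    apply hτinj (hβV _) hy
    exact ι.injective (hτβ (τ' y))
  · exact hf.comp (hTrs.comp_contMDiff (hPs.comp (contMDiff_id.prodMk contMDiff_const))
      fun u => ⟨mem_univ _, hx₀W⟩)
  · exact hTrs.comp hPs.contMDiffOn hPmaps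
  · exact hSrs.comp hPs.contMDiffOn hPmaps
  · exact fun u y hy => hTrW _ _ hy
  · exact fun u y hy => hSrW _ _ hy
  · exact fun u y hy => hSrTr _ _ hy
  · exact fun u y hy => hTrSr _ _ hy
  · intro y hy
    simp only [Tr']
    rw [map_zero, hTr0 y hy]
  · intro u y hy
    simp only [τ', Tr']
    rw [htrans _ _ hy, map_add, ContinuousLinearEquiv.apply_symm_apply]

namespace IsLocalProductNear

variable {f : X → B} {y₀ : B} {V : Set B} {τ : B → EuclideanSpace ℝ (Fin 2)}
  {β : EuclideanSpace ℝ (Fin 2) → B} {Tr Sr : EuclideanSpace ℝ (Fin 2) × X → X}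

/-- `τ` is injective on `V`. [folklore] -/
theorem injOn (h : IsLocalProductNear f y₀ V τ β Tr Sr) : InjOn τ V := fun y hy y' hy' hyy => by
  rw [← h.β_τ y hy, ← h.β_τ y' hy', hyy]

/-- `β` is injective. [folklore] -/
theorem β_injective (h : IsLocalProductNear f y₀ V τ β Tr Sr) : Injective β := fun u u' huu => by
  rw [← h.τ_β u, ← h.τ_β u', huu]

/-- `β 0 = y₀`. [folklore] -/
theorem β_zero (h : IsLocalProductNear f y₀ V τ β Tr Sr) : β 0 = y₀ := by
  rw [← h.τ_apply, h.β_τ _ h.mem]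

/-- A point of `V` with `τ = 0` is `y₀`. [folklore] -/
theorem eq_of_τ_eq_zero (h : IsLocalProductNear f y₀ V τ β Tr Sr) {y : B} (hy : y ∈ V)
    (h0 : τ y = 0) : y = y₀ :=
  h.injOn hy h.mem (h0.trans h.τ_apply.symm)

/-- The inverse translation lowers the base coordinate: `τ (f (Sr (u, y))) = τ (f y) - u`.
[folklore] -/
theorem τ_Sr (h : IsLocalProductNear f y₀ V τ β Tr Sr) (u : EuclideanSpace ℝ (Fin 2)) {y : X}
    (hy : y ∈ f ⁻¹' V) : τ (f (Sr (u, y))) = τ (f y) - u := by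
  have := h.τ_Tr u (Sr (u, y)) (h.Sr_mem u y hy)
  rw [h.Tr_Sr u y hy] at this
  rw [this, add_sub_cancel_right]

/-- `Sr (0, ·) = id` on the tube. [folklore] -/
theorem Sr_zero (h : IsLocalProductNear f y₀ V τ β Tr Sr) {y : X} (hy : y ∈ f ⁻¹' V) :
    Sr (0, y) = y := by
  have := h.Sr_Tr 0 y hy
  rwa [h.Tr_zero y hy] at this

/-- **The fibre retraction** `y ↦ Sr (τ (f y), y)` lands in the central fibre. [folklore] -/
theorem f_Sr_τ (h : IsLocalProductNear f y₀ V τ β Tr Sr) {y : X} (hy : y ∈ f ⁻¹' V) :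
    f (Sr (τ (f y), y)) = y₀ :=
  h.eq_of_τ_eq_zero (h.Sr_mem _ y hy) (by rw [h.τ_Sr _ hy, sub_self])

/-- The base point of a translate of a point of the central fibre: `f (Tr (u, x)) = β u` for
`f x = y₀`. [folklore] -/
theorem f_Tr_of_mem_fibre (h : IsLocalProductNear f y₀ V τ β Tr Sr) (u : EuclideanSpace ℝ (Fin 2))
    {x : X} (hx : f x = y₀) : f (Tr (u, x)) = β u := by
  have hxW : x ∈ f ⁻¹' V := by simpa [hx] using h.mem
  apply h.injOn (h.Tr_mem u x hxW) (h.β_mem u)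
  rw [h.τ_Tr u x hxW, hx, h.τ_apply, zero_add, h.τ_β]

/-- `τ (f (Tr (u, x))) = u` for `x` on the central fibre. [folklore] -/
theorem τ_f_Tr_of_mem_fibre (h : IsLocalProductNear f y₀ V τ β Tr Sr)
    (u : EuclideanSpace ℝ (Fin 2)) {x : X} (hx : f x = y₀) : τ (f (Tr (u, x))) = u := by
  rw [h.f_Tr_of_mem_fibre u hx, h.τ_β]

/-- Points of `V` are `β` of their coordinate. [folklore] -/
theorem eq_β_τ (h : IsLocalProductNear f y₀ V τ β Tr Sr) {y : X} (hy : y ∈ f ⁻¹' V) :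
    f y = β (τ (f y)) :=
  (h.β_τ _ hy).symm

/-- The central fibre lies in the tube. [folklore] -/
theorem mem_tube_of_mem_fibre (h : IsLocalProductNear f y₀ V τ β Tr Sr) {x : X} (hx : f x = y₀) :
    x ∈ f ⁻¹' V := by
  simpa [hx] using h.mem

/-- The tube `f⁻¹(V)` is open. [folklore] -/
theorem isOpen_tube (h : IsLocalProductNear f y₀ V τ β Tr Sr) (hf : Continuous f) :
    IsOpen (f ⁻¹' V) :=
  h.isOpen.preimage hf

end IsLocalProductNear

end LocalProduct

/-! ### The product chart of `X` near a point of the tube -/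

section Chart

variable {X : Type*} [TopologicalSpace X] [ChartedSpace (EuclideanSpace ℝ (Fin 4)) X]
  {B : Type*} [TopologicalSpace B] [ChartedSpace (EuclideanSpace ℝ (Fin 2)) B]
  {f : X → B} {y₀ : B} {V : Set B} {τ : B → EuclideanSpace ℝ (Fin 2)}
  {β : EuclideanSpace ℝ (Fin 2) → B} {Tr Sr : EuclideanSpace ℝ (Fin 2) × X → X}
  {S : Type*} [TopologicalSpace S] [ChartedSpace (EuclideanSpace ℝ (Fin 2)) S] {e : S → X}

namespace IsLocalProductNear

/-- The base coordinate `y ↦ τ (f y)` is `C^∞` on the tube. [folklore] -/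
theorem contMDiffOn_τ_comp (h : IsLocalProductNear f y₀ V τ β Tr Sr)
    (hf : ContMDiff (𝓡 4) (𝓡 2) ∞ f) :
    ContMDiffOn (𝓡 4) (𝓡 2) ∞ (fun y => τ (f y)) (f ⁻¹' V) :=
  h.contMDiffOn_τ.comp hf.contMDiffOn (mapsTo_preimage f V)

/-- **The fibre retraction `y ↦ Sr (τ (f y), y)` is `C^∞` on the tube.** [folklore] -/
theorem contMDiffOn_retraction (h : IsLocalProductNear f y₀ V τ β Tr Sr)
    (hf : ContMDiff (𝓡 4) (𝓡 2) ∞ f) :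
    ContMDiffOn (𝓡 4) (𝓡 4) ∞ (fun y => Sr (τ (f y), y)) (f ⁻¹' V) := by
  have hpair : ContMDiffOn (𝓡 4) ((𝓡 2).prod (𝓡 4)) ∞ (fun y => (τ (f y), y)) (f ⁻¹' V) :=
    (h.contMDiffOn_τ_comp hf).prodMk contMDiffOn_id
  exact h.contMDiffOn_Sr.comp hpair fun y hy => ⟨mem_univ _, hy⟩

omit [TopologicalSpace S] [ChartedSpace (EuclideanSpace ℝ (Fin 2)) S] in
/-- The fibre retraction lands in the central fibre `range e = f⁻¹(y₀)`. [folklore] -/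
theorem retraction_mem_range (h : IsLocalProductNear f y₀ V τ β Tr Sr)
    (hrange : range e = f ⁻¹' {y₀}) {y : X} (hy : y ∈ f ⁻¹' V) :
    Sr (τ (f y), y) ∈ range e := by
  rw [hrange]
  exact h.f_Sr_τ hy

/-- **The fibre coordinate `σ y = e⁻¹ (Sr (τ (f y), y))` is `C^∞` on the tube** (the inverse of
a smooth embedding is smooth on its range, Lee 2013, Prop. 4.22, as the tree's
`Literature.Geometry.Manifold.contMDiffOn_invFun_range`). [cite: LeeSmoothManifolds2013, Prop. 4.22] -/
theorem contMDiffOn_fibreCoord [Nonempty S] (h : IsLocalProductNear f y₀ V τ β Tr Sr)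
    (hf : ContMDiff (𝓡 4) (𝓡 2) ∞ f) (he : Manifold.IsSmoothEmbedding (𝓡 2) (𝓡 4) ∞ e)
    (hrange : range e = f ⁻¹' {y₀}) :
    ContMDiffOn (𝓡 4) (𝓡 2) ∞ (fun y => invFun e (Sr (τ (f y), y))) (f ⁻¹' V) :=
  (Literature.Geometry.Manifold.contMDiffOn_invFun_range he).comp (h.contMDiffOn_retraction hf)
    fun _ hy => h.retraction_mem_range hrange hy

omit [TopologicalSpace S] [ChartedSpace (EuclideanSpace ℝ (Fin 2)) S] in
/-- On the tube, `e (σ y)` is the retraction of `y`. [folklore] -/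
theorem e_fibreCoord [Nonempty S] (h : IsLocalProductNear f y₀ V τ β Tr Sr)
    (hrange : range e = f ⁻¹' {y₀}) {y : X} (hy : y ∈ f ⁻¹' V) :
    e (invFun e (Sr (τ (f y), y))) = Sr (τ (f y), y) :=
  invFun_eq (h.retraction_mem_range hrange hy)

omit [TopologicalSpace S] [ChartedSpace (EuclideanSpace ℝ (Fin 2)) S] in
/-- On the central fibre the retraction is the identity and `σ (e s) = s`. [folklore] -/
theorem fibreCoord_apply_e [Nonempty S] (h : IsLocalProductNear f y₀ V τ β Tr Sr)
    (hinj : Injective e) (hrange : range e = f ⁻¹' {y₀}) (s : S) :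
    invFun e (Sr (τ (f (e s)), e s)) = s := by
  have hes : f (e s) = y₀ := by
    have : e s ∈ f ⁻¹' {y₀} := hrange ▸ mem_range_self s
    simpa using this
  rw [hes, h.τ_apply, h.Sr_zero (h.mem_tube_of_mem_fibre hes)]
  exact leftInverse_invFun hinj s

omit [TopologicalSpace S] [ChartedSpace (EuclideanSpace ℝ (Fin 2)) S] in
/-- The coordinates of a translate `Tr (u, e s)` of a fibre point: base coordinate `u`,
retraction `e s`. [folklore] -/
theorem coords_Tr_e [Nonempty S] (h : IsLocalProductNear f y₀ V τ β Tr Sr)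
    (hinj : Injective e) (hrange : range e = f ⁻¹' {y₀}) (u : EuclideanSpace ℝ (Fin 2)) (s : S) :
    τ (f (Tr (u, e s))) = u ∧ Sr (τ (f (Tr (u, e s))), Tr (u, e s)) = e s ∧
      invFun e (Sr (τ (f (Tr (u, e s))), Tr (u, e s))) = s := by
  have hes : f (e s) = y₀ := by
    have : e s ∈ f ⁻¹' {y₀} := hrange ▸ mem_range_self s
    simpa using this
  have hu : τ (f (Tr (u, e s))) = u := h.τ_f_Tr_of_mem_fibre u hes
  have hr : Sr (τ (f (Tr (u, e s))), Tr (u, e s)) = e s := by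
    rw [hu, h.Sr_Tr u _ (h.mem_tube_of_mem_fibre hes)]
  exact ⟨hu, hr, by rw [hr]; exact leftInverse_invFun hinj s⟩

/-- **The product chart.**  For local product data near `f⁻¹(y₀) = range e` (`e : S → X` a
smooth embedding of the closed surface `S`), a chart `φ` of the maximal atlas of `S` and a linear
isomorphism `J : ℝ⁴ ≃ ℝ² × ℝ²`, the map `κ y = J⁻¹ (τ (f y), φ (σ y))` is a local
diffeomorphism of `X` onto an open subset of `ℝ⁴` — an open partial homeomorphism, `C^∞` with
`C^∞` inverse `w ↦ Tr ((J w)₁, e (φ⁻¹ (J w)₂))` — defined on `{y ∈ f⁻¹(V) | σ y ∈ φ.source}`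
(Ehresmann's product coordinates, Bröcker–Jänich 1982, (8.12)). [cite: BrockerJanichIDT1982, (8.12)] -/
theorem exists_productChart [IsManifold (𝓡 4) ∞ X] [IsManifold (𝓡 2) ∞ S] [Nonempty S]
    (h : IsLocalProductNear f y₀ V τ β Tr Sr)
    (hf : ContMDiff (𝓡 4) (𝓡 2) ∞ f) (he : Manifold.IsSmoothEmbedding (𝓡 2) (𝓡 4) ∞ e)
    (hrange : range e = f ⁻¹' {y₀}) {φ : OpenPartialHomeomorph S (EuclideanSpace ℝ (Fin 2))}
    (hφ : φ ∈ IsManifold.maximalAtlas (𝓡 2) ∞ S)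
    (J : EuclideanSpace ℝ (Fin 4) ≃L[ℝ] EuclideanSpace ℝ (Fin 2) × EuclideanSpace ℝ (Fin 2)) :
    ∃ κ : OpenPartialHomeomorph X (EuclideanSpace ℝ (Fin 4)),
      κ.source = {y ∈ f ⁻¹' V | invFun e (Sr (τ (f y), y)) ∈ φ.source} ∧
      κ.target = {w | (J w).2 ∈ φ.target} ∧
      (∀ y, κ y = J.symm (τ (f y), φ (invFun e (Sr (τ (f y), y))))) ∧
      (∀ w, κ.symm w = Tr ((J w).1, e (φ.symm (J w).2))) ∧
      ContMDiffOn (𝓡 4) (𝓡 4) ∞ κ κ.source ∧ ContMDiffOn (𝓡 4) (𝓡 4) ∞ κ.symm κ.target := by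
  have hinj : Injective e := he.isEmbedding.injective
  have hes : ContMDiff (𝓡 2) (𝓡 4) ∞ e := he.contMDiff
  have hW : IsOpen (f ⁻¹' V) := h.isOpen_tube hf.continuous
  have hσ := h.contMDiffOn_fibreCoord hf he hrange
  have hfe : ∀ s, f (e s) = y₀ := fun s => by
    have : e s ∈ f ⁻¹' {y₀} := hrange ▸ mem_range_self s
    simpa using this
  -- the two maps
  set F₁ : X → EuclideanSpace ℝ (Fin 4) :=
    fun y => J.symm (τ (f y), φ (invFun e (Sr (τ (f y), y)))) with hF₁
  set F₂ : EuclideanSpace ℝ (Fin 4) → X := fun w => Tr ((J w).1, e (φ.symm (J w).2)) with hF₂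
  set src : Set X := {y ∈ f ⁻¹' V | invFun e (Sr (τ (f y), y)) ∈ φ.source} with hsrc
  set tgt : Set (EuclideanSpace ℝ (Fin 4)) := {w | (J w).2 ∈ φ.target} with htgt
  have hsrc_open : IsOpen src := hσ.continuousOn.isOpen_inter_preimage hW φ.open_source
  have hJ2 : Continuous fun w : EuclideanSpace ℝ (Fin 4) => (J w).2 := continuous_snd.comp J.continuous
  have htgt_open : IsOpen tgt := φ.open_target.preimage hJ2
  -- smoothness of `F₁` on `src`
  have hF₁s : ContMDiffOn (𝓡 4) (𝓡 4) ∞ F₁ src := by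
    have h1 : ContMDiffOn (𝓡 4) 𝓘(ℝ, EuclideanSpace ℝ (Fin 2)) ∞ (fun y => τ (f y)) src :=
      (h.contMDiffOn_τ_comp hf).mono (sep_subset _ _)
    have h2 : ContMDiffOn (𝓡 4) 𝓘(ℝ, EuclideanSpace ℝ (Fin 2)) ∞
        (fun y => φ (invFun e (Sr (τ (f y), y)))) src :=
      (contMDiffOn_of_mem_maximalAtlas hφ).comp (hσ.mono (sep_subset _ _)) fun y hy => hy.2
    have h12 := h1.prodMk_space h2
    exact J.symm.contDiff.contMDiff.comp_contMDiffOn h12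
  -- smoothness of `F₂` on `tgt`
  have hF₂s : ContMDiffOn (𝓡 4) (𝓡 4) ∞ F₂ tgt := by
    have h1 : ContMDiff (𝓡 4) (𝓡 2) ∞ (fun w : EuclideanSpace ℝ (Fin 4) => (J w).1) :=
      (contDiff_fst.comp J.contDiff).contMDiff
    have h2' : ContMDiff (𝓡 4) (𝓡 2) ∞ (fun w : EuclideanSpace ℝ (Fin 4) => (J w).2) :=
      (contDiff_snd.comp J.contDiff).contMDiff
    have h2 : ContMDiffOn (𝓡 4) (𝓡 4) ∞ (fun w => e (φ.symm (J w).2)) tgt :=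
      hes.comp_contMDiffOn ((contMDiffOn_symm_of_mem_maximalAtlas hφ).comp h2'.contMDiffOn
        fun w hw => hw)
    have h12 : ContMDiffOn (𝓡 4) ((𝓡 2).prod (𝓡 4)) ∞
        (fun w => ((J w).1, e (φ.symm (J w).2))) tgt := h1.contMDiffOn.prodMk h2
    exact h.contMDiffOn_Tr.comp h12 fun w _ => ⟨mem_univ _, h.mem_tube_of_mem_fibre (hfe _)⟩
  -- the chart
  refine ⟨
    { toFun := F₁
      invFun := F₂
      source := src
      target := tgt
      map_source' := ?_
      map_target' := ?_
      left_inv' := ?_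
      right_inv' := ?_
      open_source := hsrc_open
      open_target := htgt_open
      continuousOn_toFun := hF₁s.continuousOn
      continuousOn_invFun := hF₂s.continuousOn }, rfl, rfl, fun y => rfl, fun w => rfl, hF₁s, hF₂s⟩
  · intro y hy
    show (J (J.symm _)).2 ∈ φ.target
    rw [J.apply_symm_apply]
    exact φ.map_source hy.2
  · intro w hw
    obtain ⟨hu, -, hs⟩ := h.coords_Tr_e hinj hrange (J w).1 (φ.symm (J w).2)
    refine ⟨h.Tr_mem _ _ (h.mem_tube_of_mem_fibre (hfe _)), ?_⟩
    show invFun e (Sr (τ (f (F₂ w)), F₂ w)) ∈ φ.source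
    rw [hF₂, hs]
    exact φ.map_target hw
  · intro y hy
    show F₂ (F₁ y) = y
    simp only [hF₁, hF₂, J.apply_symm_apply, φ.left_inv hy.2, h.e_fibreCoord hrange hy.1]
    exact h.Tr_Sr _ _ hy.1
  · intro w hw
    obtain ⟨hu, -, hs⟩ := h.coords_Tr_e hinj hrange (J w).1 (φ.symm (J w).2)
    show F₁ (F₂ w) = w
    simp only [hF₁, hF₂] at hu hs ⊢
    rw [hs, hu, φ.right_inv hw]
    exact J.symm_apply_apply w

end IsLocalProductNear

end Chart

/-! ### The base chart, the perturbed function and its local representative -/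

section Perturb

variable {X : Type*} [TopologicalSpace X] [ChartedSpace (EuclideanSpace ℝ (Fin 4)) X]
  {B : Type*} [TopologicalSpace B] [ChartedSpace (EuclideanSpace ℝ (Fin 2)) B]
  {f : X → B} {y₀ : B} {V : Set B} {τ : B → EuclideanSpace ℝ (Fin 2)}
  {β : EuclideanSpace ℝ (Fin 2) → B} {Tr Sr : EuclideanSpace ℝ (Fin 2) × X → X}
  {S : Type*} [TopologicalSpace S] [ChartedSpace (EuclideanSpace ℝ (Fin 2)) S] {e : S → X}

namespace IsLocalProductNear

/-- **The base chart** `τ : V ≅ ℝ²` as an open partial homeomorphism of `B`, `C^∞` with `C^∞`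
inverse `β` (so a chart of the maximal atlas of `B`). [cite: BrockerJanichIDT1982, (8.12)] -/
theorem exists_baseChart (h : IsLocalProductNear f y₀ V τ β Tr Sr) :
    ∃ ψ₀ : OpenPartialHomeomorph B (EuclideanSpace ℝ (Fin 2)),
      ψ₀.source = V ∧ ψ₀.target = univ ∧ (∀ y, ψ₀ y = τ y) ∧ (∀ u, ψ₀.symm u = β u) ∧
      ContMDiffOn (𝓡 2) (𝓡 2) ∞ ψ₀ ψ₀.source ∧ ContMDiffOn (𝓡 2) (𝓡 2) ∞ ψ₀.symm ψ₀.target := by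
  refine ⟨
    { toFun := τ
      invFun := β
      source := V
      target := univ
      map_source' := fun _ _ => mem_univ _
      map_target' := fun u _ => h.β_mem u
      left_inv' := fun y hy => h.β_τ y hy
      right_inv' := fun u _ => h.τ_β u
      open_source := h.isOpen
      open_target := isOpen_univ
      continuousOn_toFun := h.contMDiffOn_τ.continuousOn
      continuousOn_invFun := h.contMDiff_β.continuous.continuousOn }, rfl, rfl, fun _ => rfl,
    fun _ => rfl, h.contMDiffOn_τ, h.contMDiff_β.contMDiffOn⟩

/-- **Morse data of `ℓ` at `y₀` read in the base chart**: with `λ = ℓ ∘ β`, `y₀` is critical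
for `ℓ` iff `Dλ(0) = 0`, and then the Hessian of `ℓ` at `y₀` is nondegenerate iff `D²λ(0)` is,
with the same index (Milnor 1963, §2). [cite: Milnor1963, §2] -/
theorem morseData_base [IsManifold (𝓡 2) ∞ B] (h : IsLocalProductNear f y₀ V τ β Tr Sr)
    {ℓ : B → ℝ} (hℓ : ContMDiff (𝓡 2) 𝓘(ℝ, ℝ) ∞ ℓ) :
    (IsMCriticalPt (𝓡 2) ℓ y₀ ↔ fderiv ℝ (ℓ ∘ β) 0 = 0) ∧
    (IsMCriticalPt (𝓡 2) ℓ y₀ →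
      ((mhessian (𝓡 2) ℓ y₀).Nondegenerate ↔ (mhessian (𝓡 2) (ℓ ∘ β) 0).Nondegenerate) ∧
        morseIndex (𝓡 2) ℓ y₀ = morseIndex (𝓡 2) (ℓ ∘ β) 0) := by
  obtain ⟨ψ₀, hsrc, -, hψ, hψs, hs, hs'⟩ := h.exists_baseChart
  have hy₀ : y₀ ∈ ψ₀.source := hsrc ▸ h.mem
  have hlam : ContDiff ℝ ∞ (ℓ ∘ β) := contMDiff_iff_contDiff.1 (hℓ.comp h.contMDiff_β)
  have h0 : ψ₀ y₀ = 0 := by rw [hψ, h.τ_apply]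
  have hfG : ℓ ∘ ψ₀.symm =ᶠ[𝓝 (ψ₀ y₀)] ℓ ∘ β :=
    Filter.Eventually.of_forall fun u => by simp [Function.comp_apply, hψs]
  have := morseData_of_localRepresentative (n := 1) hs hs' hy₀
    (G := ℓ ∘ β) (by rw [h0]; exact (hlam.of_le (by norm_cast)).contDiffAt) hfG
  rwa [h0] at this

end IsLocalProductNear

/-- **The fibrewise Morse perturbation** of `g` in the tube `f⁻¹(V)`:
`g̃ y = g y + ε χ(τ (f y)) μ(σ y)`, where `σ y = e⁻¹ (Sr (τ (f y), y))` is the fibre coordinate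
and `χ` a bump function at `0 ∈ ℝ²`; outside the tube `g̃ = g` (Milnor 1963, §2–§3: the standard
perturbation making a Morse–Bott critical fibre Morse). [cite: Milnor1963, §3] -/
def fibrePerturb [Nonempty S] (f : X → B) (V : Set B) (τ : B → EuclideanSpace ℝ (Fin 2))
    (Sr : EuclideanSpace ℝ (Fin 2) × X → X) (e : S → X) (g : X → ℝ)
    (χ : EuclideanSpace ℝ (Fin 2) → ℝ) (μ : S → ℝ) (ε : ℝ) : X → ℝ :=
  fun y => g y + ε * (f ⁻¹' V).indicator (fun y => χ (τ (f y)) * μ (invFun e (Sr (τ (f y), y)))) y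

omit [TopologicalSpace X] [ChartedSpace (EuclideanSpace ℝ (Fin 4)) X] [TopologicalSpace B]
  [ChartedSpace (EuclideanSpace ℝ (Fin 2)) B] [TopologicalSpace S]
  [ChartedSpace (EuclideanSpace ℝ (Fin 2)) S] in
/-- In the tube the perturbation is the explicit formula. [folklore] -/
theorem fibrePerturb_apply_of_mem [Nonempty S] {g : X → ℝ} {χ : EuclideanSpace ℝ (Fin 2) → ℝ}
    {μ : S → ℝ} {ε : ℝ} {y : X} (hy : y ∈ f ⁻¹' V) :
    fibrePerturb f V τ Sr e g χ μ ε y =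
      g y + ε * (χ (τ (f y)) * μ (invFun e (Sr (τ (f y), y)))) := by
  simp only [fibrePerturb, indicator_of_mem hy]

omit [TopologicalSpace X] [ChartedSpace (EuclideanSpace ℝ (Fin 4)) X] [TopologicalSpace B]
  [ChartedSpace (EuclideanSpace ℝ (Fin 2)) B] [TopologicalSpace S]
  [ChartedSpace (EuclideanSpace ℝ (Fin 2)) S] in
/-- Outside the tube the perturbation is `g`. [folklore] -/
theorem fibrePerturb_apply_of_not_mem [Nonempty S] {g : X → ℝ} {χ : EuclideanSpace ℝ (Fin 2) → ℝ}
    {μ : S → ℝ} {ε : ℝ} {y : X} (hy : y ∉ f ⁻¹' V) :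
    fibrePerturb f V τ Sr e g χ μ ε y = g y := by
  simp only [fibrePerturb, indicator_of_notMem hy, mul_zero, add_zero]

namespace IsLocalProductNear

omit [TopologicalSpace S] [ChartedSpace (EuclideanSpace ℝ (Fin 2)) S] in
/-- **The perturbation agrees with `g` off `f⁻¹(β(B̄(0, r)))`** as soon as the bump vanishes
outside the ball of radius `r`. [folklore] -/
theorem fibrePerturb_eq_of_not_mem [Nonempty S] (h : IsLocalProductNear f y₀ V τ β Tr Sr)
    {g : X → ℝ} {χ : EuclideanSpace ℝ (Fin 2) → ℝ} {μ : S → ℝ} {ε r : ℝ}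
    (hχ : ∀ u, r ≤ ‖u‖ → χ u = 0) {y : X} (hy : f y ∉ β '' Metric.closedBall 0 r) :
    fibrePerturb f V τ Sr e g χ μ ε y = g y := by
  by_cases hyW : y ∈ f ⁻¹' V
  · rw [fibrePerturb_apply_of_mem hyW]
    have hr : r ≤ ‖τ (f y)‖ :=
      le_of_not_gt fun hlt => hy ⟨τ (f y), by simpa using hlt.le, h.β_τ _ hyW⟩
    rw [hχ _ hr, zero_mul, mul_zero, add_zero]
  · exact fibrePerturb_apply_of_not_mem hyW

omit [TopologicalSpace S] [ChartedSpace (EuclideanSpace ℝ (Fin 2)) S] in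
/-- Hence `g̃` and `g` have the same germ at every point not over the compact
`K = β(B̄(0, r))` (for `B` Hausdorff). [folklore] -/
theorem fibrePerturb_eventuallyEq [T2Space B] [Nonempty S] (h : IsLocalProductNear f y₀ V τ β Tr Sr)
    (hf : Continuous f) {g : X → ℝ} {χ : EuclideanSpace ℝ (Fin 2) → ℝ} {μ : S → ℝ} {ε r : ℝ}
    (hχ : ∀ u, r ≤ ‖u‖ → χ u = 0) {y : X} (hy : f y ∉ β '' Metric.closedBall 0 r) :
    fibrePerturb f V τ Sr e g χ μ ε =ᶠ[𝓝 y] g := by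
  have hK : IsClosed (β '' Metric.closedBall (0 : EuclideanSpace ℝ (Fin 2)) r) :=
    ((isCompact_closedBall 0 r).image h.contMDiff_β.continuous).isClosed
  have hopen : IsOpen (f ⁻¹' (β '' Metric.closedBall (0 : EuclideanSpace ℝ (Fin 2)) r))ᶜ :=
    (hK.preimage hf).isOpen_compl
  filter_upwards [hopen.mem_nhds hy] with z hz
  exact h.fibrePerturb_eq_of_not_mem hχ hz

/-- **The perturbation is `C^∞`** when `g`, `χ`, `μ` are and `χ` vanishes outside a ball (so
that `g̃ = g` near the boundary of the tube). [folklore] -/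
theorem contMDiff_fibrePerturb [IsManifold (𝓡 4) ∞ X] [T2Space B] [IsManifold (𝓡 2) ∞ S]
    [Nonempty S] (h : IsLocalProductNear f y₀ V τ β Tr Sr) (hf : ContMDiff (𝓡 4) (𝓡 2) ∞ f)
    (he : Manifold.IsSmoothEmbedding (𝓡 2) (𝓡 4) ∞ e) (hrange : range e = f ⁻¹' {y₀})
    {g : X → ℝ} (hg : ContMDiff (𝓡 4) 𝓘(ℝ, ℝ) ∞ g) {χ : EuclideanSpace ℝ (Fin 2) → ℝ}
    (hχs : ContDiff ℝ ∞ χ) {r : ℝ} (hχ : ∀ u, r ≤ ‖u‖ → χ u = 0) {μ : S → ℝ}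
    (hμ : ContMDiff (𝓡 2) 𝓘(ℝ, ℝ) ∞ μ) (ε : ℝ) :
    ContMDiff (𝓡 4) 𝓘(ℝ, ℝ) ∞ (fibrePerturb f V τ Sr e g χ μ ε) := by
  intro y
  by_cases hyK : f y ∈ β '' Metric.closedBall 0 r
  · -- `y` lies in the (open) tube, where `g̃` is the explicit formula
    have hyW : y ∈ f ⁻¹' V := by
      obtain ⟨u, -, hu⟩ := hyK
      show f y ∈ V
      rw [← hu]; exact h.β_mem u
    have hW : IsOpen (f ⁻¹' V) := h.isOpen_tube hf.continuous
    have hform : ContMDiffOn (𝓡 4) 𝓘(ℝ, ℝ) ∞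
        (fun y => g y + ε * (χ (τ (f y)) * μ (invFun e (Sr (τ (f y), y))))) (f ⁻¹' V) := by
      have h1 : ContMDiffOn (𝓡 4) 𝓘(ℝ, ℝ) ∞ (fun y => χ (τ (f y))) (f ⁻¹' V) :=
        hχs.contMDiff.comp_contMDiffOn (h.contMDiffOn_τ_comp hf)
      have h2 : ContMDiffOn (𝓡 4) 𝓘(ℝ, ℝ) ∞ (fun y => μ (invFun e (Sr (τ (f y), y)))) (f ⁻¹' V) :=
        hμ.comp_contMDiffOn (h.contMDiffOn_fibreCoord hf he hrange)
      exact hg.contMDiffOn.add (contMDiffOn_const.mul (h1.mul h2))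
    have hev : fibrePerturb f V τ Sr e g χ μ ε =ᶠ[𝓝 y]
        fun y => g y + ε * (χ (τ (f y)) * μ (invFun e (Sr (τ (f y), y)))) := by
      filter_upwards [hW.mem_nhds hyW] with z hz
      exact fibrePerturb_apply_of_mem hz
    exact ((hform y hyW).contMDiffAt (hW.mem_nhds hyW)).congr_of_eventuallyEq hev
  · exact (hg y).congr_of_eventuallyEq (h.fibrePerturb_eventuallyEq hf.continuous hχ hyK)

omit [ChartedSpace (EuclideanSpace ℝ (Fin 2)) S] in
/-- **The local representative of the perturbation in a product chart** is the model function
`w ↦ λ (J w)₁ + ε χ (J w)₁ μ̂ (J w)₂` with `λ = ℓ ∘ β`, `μ̂ = μ ∘ φ⁻¹` — provided `g = ℓ ∘ f`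
over `V` (an identity of functions on all of `ℝ⁴`, the inverse chart being the global formula
`w ↦ Tr ((J w)₁, e (φ⁻¹ (J w)₂))`). [cite: Milnor1963, §3] -/
theorem fibrePerturb_comp_productChart_symm [Nonempty S] (h : IsLocalProductNear f y₀ V τ β Tr Sr)
    {O : Set B} (hVO : V ⊆ O) {ℓ : B → ℝ} {g : X → ℝ} (hgℓ : ∀ x, f x ∈ O → g x = ℓ (f x))
    (hinj : Injective e) (hrange : range e = f ⁻¹' {y₀})
    {φ : OpenPartialHomeomorph S (EuclideanSpace ℝ (Fin 2))}
    {J : EuclideanSpace ℝ (Fin 4) ≃L[ℝ] EuclideanSpace ℝ (Fin 2) × EuclideanSpace ℝ (Fin 2)}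
    {κ : OpenPartialHomeomorph X (EuclideanSpace ℝ (Fin 4))}
    (hκs : ∀ w, κ.symm w = Tr ((J w).1, e (φ.symm (J w).2)))
    (χ : EuclideanSpace ℝ (Fin 2) → ℝ) (μ : S → ℝ) (ε : ℝ) (w : EuclideanSpace ℝ (Fin 4)) :
    (fibrePerturb f V τ Sr e g χ μ ε ∘ κ.symm) w =
      (ℓ ∘ β) (J w).1 + ε * (χ (J w).1 * (μ ∘ φ.symm) (J w).2) := by
  have hfe : ∀ s, f (e s) = y₀ := fun s => by
    have : e s ∈ f ⁻¹' {y₀} := hrange ▸ mem_range_self s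
    simpa using this
  obtain ⟨hu, -, hs⟩ := h.coords_Tr_e hinj hrange (J w).1 (φ.symm (J w).2)
  have hW : κ.symm w ∈ f ⁻¹' V := by
    rw [hκs]; exact h.Tr_mem _ _ (h.mem_tube_of_mem_fibre (hfe _))
  simp only [Function.comp_apply]
  rw [fibrePerturb_apply_of_mem hW, hgℓ _ (hVO hW), hκs, hs, hu,
    h.f_Tr_of_mem_fibre _ (hfe _)]

end IsLocalProductNear

end Perturb

/-! ### Morse data of the perturbation over the bump region -/

section MorseData

variable {X : Type*} [TopologicalSpace X] [ChartedSpace (EuclideanSpace ℝ (Fin 4)) X]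
  [IsManifold (𝓡 4) ∞ X]
  {B : Type*} [TopologicalSpace B] [ChartedSpace (EuclideanSpace ℝ (Fin 2)) B]
  [IsManifold (𝓡 2) ∞ B]
  {f : X → B} {y₀ : B} {V : Set B} {τ : B → EuclideanSpace ℝ (Fin 2)}
  {β : EuclideanSpace ℝ (Fin 2) → B} {Tr Sr : EuclideanSpace ℝ (Fin 2) × X → X}
  {S : Type*} [TopologicalSpace S] [ChartedSpace (EuclideanSpace ℝ (Fin 2)) S]
  [IsManifold (𝓡 2) ∞ S] {e : S → X}

/-- **Critical points and Hessians of the perturbation `g̃ = ℓ(u) + ε χ(u) μ(s)` over the bump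
region** (Milnor 1963, §2–§3).  Hypotheses: local product data near `f⁻¹(y₀) = range e`,
`g = ℓ ∘ f` over `V`, `ℓ` with a nondegenerate critical point at `y₀`, `μ` Morse on the closed
surface `S`, `χ` a bump at `0 ∈ ℝ²`, `ε > 0`; `Dλ ≠ 0` on `0 < ‖u‖ ≤ r_out` (`λ = ℓ ∘ β`; the
critical point `0` is isolated) and `Dλ + ε μ(s) Dχ ≠ 0` on the annulus `r_in ≤ ‖u‖ ≤ r_out`
(`ε` small).  Conclusion, at a point `y` of the tube with `‖τ (f y)‖ ≤ r_out`: `y` is critical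
for `g̃` iff `τ (f y) = 0` (i.e. `f y = y₀`) and the fibre coordinate `σ y` is critical for `μ`;
and then the Hessian of `g̃` at `y` is nondegenerate of index `ind_{y₀} ℓ + ind_{σ y} μ` — in the
product chart the Hessian is the block sum `D²λ(0) ⊕ ε D²μ̂`. [cite: Milnor1963, §3] -/
theorem IsLocalProductNear.morseData_fibrePerturb [Nonempty S]
    (h : IsLocalProductNear f y₀ V τ β Tr Sr) (hf : ContMDiff (𝓡 4) (𝓡 2) ∞ f)
    {O : Set B} (hVO : V ⊆ O) {ℓ : B → ℝ} (hℓ : ContMDiff (𝓡 2) 𝓘(ℝ, ℝ) ∞ ℓ)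
    (hcrit : IsMCriticalPt (𝓡 2) ℓ y₀) (hnd : (mhessian (𝓡 2) ℓ y₀).Nondegenerate)
    {g : X → ℝ} (hgℓ : ∀ x, f x ∈ O → g x = ℓ (f x))
    (he : Manifold.IsSmoothEmbedding (𝓡 2) (𝓡 4) ∞ e) (hrange : range e = f ⁻¹' {y₀})
    {μ : S → ℝ} (hμ : IsMorse (𝓡 2) μ) (χ : ContDiffBump (0 : EuclideanSpace ℝ (Fin 2)))
    {ε : ℝ} (hε : 0 < ε)
    (hisol : ∀ u, u ≠ 0 → ‖u‖ ≤ χ.rOut → fderiv ℝ (ℓ ∘ β) u ≠ 0)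
    (hann : ∀ u, χ.rIn ≤ ‖u‖ → ‖u‖ ≤ χ.rOut → ∀ s : S,
      fderiv ℝ (ℓ ∘ β) u + (ε * μ s) • fderiv ℝ χ u ≠ 0)
    {y : X} (hy : y ∈ f ⁻¹' V) (hyr : ‖τ (f y)‖ ≤ χ.rOut) :
    (IsMCriticalPt (𝓡 4) (fibrePerturb f V τ Sr e g χ μ ε) y ↔
        τ (f y) = 0 ∧ IsMCriticalPt (𝓡 2) μ (invFun e (Sr (τ (f y), y)))) ∧
    (IsMCriticalPt (𝓡 4) (fibrePerturb f V τ Sr e g χ μ ε) y →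
      (mhessian (𝓡 4) (fibrePerturb f V τ Sr e g χ μ ε) y).Nondegenerate ∧
        morseIndex (𝓡 4) (fibrePerturb f V τ Sr e g χ μ ε) y =
          morseIndex (𝓡 2) ℓ y₀ + morseIndex (𝓡 2) μ (invFun e (Sr (τ (f y), y)))) := by
  set g' := fibrePerturb f V τ Sr e g χ μ ε with hg'
  set u₁ : EuclideanSpace ℝ (Fin 2) := τ (f y) with hu₁
  set s₁ : S := invFun e (Sr (u₁, y)) with hs₁
  set φ := chartAt (EuclideanSpace ℝ (Fin 2)) s₁ with hφ
  have hφatlas : φ ∈ IsManifold.maximalAtlas (𝓡 2) ∞ S := IsManifold.chart_mem_maximalAtlas s₁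
  have hφs : ContMDiffOn (𝓡 2) (𝓡 2) ∞ φ φ.source := contMDiffOn_of_mem_maximalAtlas hφatlas
  have hφs' : ContMDiffOn (𝓡 2) (𝓡 2) ∞ φ.symm φ.target :=
    contMDiffOn_symm_of_mem_maximalAtlas hφatlas
  have hs₁φ : s₁ ∈ φ.source := mem_chart_source _ s₁
  set lam : EuclideanSpace ℝ (Fin 2) → ℝ := ℓ ∘ β with hlam
  set μh : EuclideanSpace ℝ (Fin 2) → ℝ := μ ∘ φ.symm with hμh
  set v₁ : EuclideanSpace ℝ (Fin 2) := φ s₁ with hv₁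
  have hv₁t : v₁ ∈ φ.target := φ.map_source hs₁φ
  have hμv : μh v₁ = μ s₁ := by simp only [hμh, hv₁, Function.comp_apply, φ.left_inv hs₁φ]
  -- a linear identification `ℝ⁴ ≃ ℝ² × ℝ²` and the product chart
  obtain ⟨J⟩ : Nonempty (EuclideanSpace ℝ (Fin 4) ≃L[ℝ]
      EuclideanSpace ℝ (Fin 2) × EuclideanSpace ℝ (Fin 2)) :=
    ⟨ContinuousLinearEquiv.ofFinrankEq (by simp [Module.finrank_prod])⟩
  obtain ⟨κ, hκsrc, -, hκ, hκsymm, hκs, hκs'⟩ := h.exists_productChart hf he hrange hφatlas J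
  have hinj : Injective e := he.isEmbedding.injective
  have hyκ : y ∈ κ.source := by rw [hκsrc]; exact ⟨hy, hs₁φ⟩
  have hJκy : J (κ y) = (u₁, v₁) := by rw [hκ y, J.apply_symm_apply]
  -- smoothness of the ingredients
  have hlam_s : ContDiff ℝ ∞ lam := contMDiff_iff_contDiff.1 (hℓ.comp h.contMDiff_β)
  have hμh_s : ContDiffOn ℝ ∞ μh φ.target :=
    contMDiffOn_iff_contDiffOn.1 (hμ.contMDiff.comp_contMDiffOn hφs')
  have hμh_at : ContDiffAt ℝ ∞ μh v₁ := hμh_s.contDiffAt (φ.open_target.mem_nhds hv₁t)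
  -- Morse data of `ℓ` at `y₀` in the base chart, of `μ` at `s₁` in `φ`
  obtain ⟨hbase₁, hbase₂⟩ := h.morseData_base hℓ
  have hlam0 : fderiv ℝ lam 0 = 0 := hbase₁.1 hcrit
  obtain ⟨hB₁nd, hB₁ind⟩ := hbase₂ hcrit
  replace hB₁nd := hB₁nd.1 hnd
  obtain ⟨hμcrit_iff, hμdata⟩ := morseData_of_localRepresentative (n := 1) (f := μ) hφs hφs'
    hs₁φ (G := μh) (hμh_at.of_le (by norm_cast)) Filter.EventuallyEq.rfl
  -- the local representative of `g̃` in `κ`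
  set G : EuclideanSpace ℝ (Fin 4) → ℝ :=
    fun w => lam (J w).1 + ε * (χ (J w).1 * μh (J w).2) with hG
  have hJ1 : ContDiff ℝ ∞ fun w : EuclideanSpace ℝ (Fin 4) => (J w).1 := contDiff_fst.comp J.contDiff
  have hJ2 : ContDiff ℝ ∞ fun w : EuclideanSpace ℝ (Fin 4) => (J w).2 := contDiff_snd.comp J.contDiff
  have hG_at : ContDiffAt ℝ 2 G (κ y) := by
    have hA : ContDiffAt ℝ 2 (fun w => lam (J w).1) (κ y) :=
      ((hlam_s.comp hJ1).of_le (by norm_cast)).contDiffAt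
    have hBχ : ContDiffAt ℝ 2 (fun w => χ (J w).1) (κ y) :=
      ((χ.contDiff.comp hJ1).of_le (by norm_cast)).contDiffAt
    have hC : ContDiffAt ℝ 2 (fun w => μh (J w).2) (κ y) := by
      have h2 : ContDiffAt ℝ 2 μh ((fun w : EuclideanSpace ℝ (Fin 4) => (J w).2) (κ y)) := by
        rw [show (fun w : EuclideanSpace ℝ (Fin 4) => (J w).2) (κ y) = v₁ by simp only [hJκy]]
        exact hμh_at.of_le (by norm_cast)
      exact ContDiffAt.comp (g := μh) (f := fun w : EuclideanSpace ℝ (Fin 4) => (J w).2) (κ y) h2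
        (hJ2.of_le (by norm_cast)).contDiffAt
    exact hA.add (contDiffAt_const.mul (hBχ.mul hC))
  have hfG : g' ∘ κ.symm =ᶠ[𝓝 (κ y)] G :=
    Filter.Eventually.of_forall fun w =>
      h.fibrePerturb_comp_productChart_symm hVO hgℓ hinj hrange hκsymm χ μ ε w
  obtain ⟨hcritG, hdataG⟩ := morseData_of_localRepresentative (n := 3) hκs hκs' hyκ hG_at hfG
  -- criticality of the model at `κ y`
  have hcrit_iff : fderiv ℝ G (κ y) = 0 ↔
      fderiv ℝ lam u₁ + (ε * μ s₁) • fderiv ℝ χ u₁ = 0 ∧ (ε * χ u₁) • fderiv ℝ μh v₁ = 0 := by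
    have hl : DifferentiableAt ℝ lam (J (κ y)).1 := hlam_s.contDiffAt.differentiableAt (by simp)
    have hχd : DifferentiableAt ℝ χ (J (κ y)).1 :=
      (χ.contDiff (n := 1)).contDiffAt.differentiableAt (by simp)
    have hμd : DifferentiableAt ℝ μh (J (κ y)).2 := by
      rw [hJκy]; exact hμh_at.differentiableAt (by simp)
    have key := fderiv_blockModel_eq_zero_iff J ε hl hχd hμd
    rw [hJκy] at key
    rw [key, hμv]
  rcases lt_or_ge ‖u₁‖ χ.rIn with hin | hout
  · -- the inner region: `χ ≡ 1` near `u₁`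
    have hχ1 : (χ : EuclideanSpace ℝ (Fin 2) → ℝ) =ᶠ[𝓝 u₁] fun _ => 1 := by
      have hball : Metric.ball (0 : EuclideanSpace ℝ (Fin 2)) χ.rIn ∈ 𝓝 u₁ :=
        Metric.isOpen_ball.mem_nhds (by simpa using hin)
      filter_upwards [hball] with u hu
      exact χ.one_of_mem_closedBall (Metric.ball_subset_closedBall hu)
    have hχu : χ u₁ = 1 := hχ1.self_of_nhds
    have hDχ : fderiv ℝ χ u₁ = 0 := by rw [hχ1.fderiv_eq]; exact fderiv_const_apply _
    have hA : IsMCriticalPt (𝓡 4) g' y ↔ u₁ = 0 ∧ IsMCriticalPt (𝓡 2) μ s₁ := by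
      rw [hcritG, hcrit_iff, hDχ, hχu, smul_zero, add_zero, mul_one, smul_eq_zero, hμcrit_iff]
      constructor
      · rintro ⟨h1, h2⟩
        exact ⟨by_contra fun hne => hisol u₁ hne hyr h1, h2.resolve_left hε.ne'⟩
      · rintro ⟨h1, h2⟩
        refine ⟨?_, Or.inr h2⟩
        rw [h1]; exact hlam0
    refine ⟨hA, fun hc => ?_⟩
    obtain ⟨hu0, hμc⟩ := hA.1 hc
    obtain ⟨hndG, hindG⟩ := hdataG hc
    obtain ⟨hB₂nd, hB₂ind⟩ := hμdata hμc
    replace hB₂nd := hB₂nd.1 (hμ.nondegenerate hμc)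
    -- the Hessian of the model is the block sum `D²λ(0) ⊕ ε D²μ̂(v₁)`
    have hHess : ∀ a b, mhessian (𝓡 4) G (κ y) a b =
        mhessian (𝓡 2) lam 0 (J a).1 (J b).1 + ε * mhessian (𝓡 2) μh v₁ (J a).2 (J b).2 := by
      intro a b
      rw [MorseBirth.mhessian_model_apply (n := 3), MorseBirth.mhessian_model_apply (n := 1),
        MorseBirth.mhessian_model_apply (n := 1)]
      have hl2 : ContDiffAt ℝ 2 lam (J (κ y)).1 := (hlam_s.of_le (by norm_cast)).contDiffAt
      have hχev : (χ : EuclideanSpace ℝ (Fin 2) → ℝ) =ᶠ[𝓝 (J (κ y)).1] fun _ => 1 := by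
        rw [hJκy]; exact hχ1
      have hμ2 : ContDiffAt ℝ 2 μh (J (κ y)).2 := by
        rw [hJκy]; exact hμh_at.of_le (by norm_cast)
      rw [fderiv_fderiv_blockModel_apply J ε hl2 hχev hμ2 a b, hJκy, hu0]
    have hB₁symm : (mhessian (𝓡 2) lam 0).IsSymm := ⟨fun a b => by
      rw [MorseBirth.mhessian_model_apply (n := 1), MorseBirth.mhessian_model_apply (n := 1)]
      exact (hlam_s.of_le (m := 2) (by norm_cast)).contDiffAt.isSymmSndFDerivAt (by simp) a b⟩
    have hB₂symm : (mhessian (𝓡 2) μh v₁).IsSymm := ⟨fun a b => by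
      rw [MorseBirth.mhessian_model_apply (n := 1), MorseBirth.mhessian_model_apply (n := 1)]
      have hμ2 : ContDiffAt ℝ 2 μh v₁ := hμh_at.of_le (by norm_cast)
      exact hμ2.isSymmSndFDerivAt (by simp) a b⟩
    have hHess' : ∀ a b, mhessian (𝓡 4) G (κ y) a b =
        mhessian (𝓡 2) lam 0 (J.toLinearEquiv a).1 (J.toLinearEquiv b).1 +
          ε * mhessian (𝓡 2) μh v₁ (J.toLinearEquiv a).2 (J.toLinearEquiv b).2 := fun a b => by
      simpa using hHess a b
    refine ⟨hndG.2 (nondegenerate_of_forall_apply_eq_blockSum J.toLinearEquiv hε.ne' hB₁nd hB₂nd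
      hHess'), ?_⟩
    rw [hindG, hB₁ind, hB₂ind]
    exact sigNeg_eq_add_of_forall_apply_eq_blockSum J.toLinearEquiv hε hB₁symm hB₂symm hHess'
  · -- the annulus: `y` is not critical (and `u₁ ≠ 0`)
    have hne : ¬ IsMCriticalPt (𝓡 4) g' y := by
      rw [hcritG, hcrit_iff]
      exact fun hc => hann u₁ hout hyr s₁ hc.1
    have hu0 : u₁ ≠ 0 := by
      intro h0
      rw [h0, norm_zero] at hout
      exact absurd hout (not_le.2 χ.rIn_pos)
    exact ⟨⟨fun hc => absurd hc hne, fun hc => absurd hc.1 hu0⟩, fun hc => absurd hc hne⟩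

end MorseData

/-! ### Signed count of a finite critical set -/

section Count

variable {E H : Type*} [NormedAddCommGroup E] [NormedSpace ℝ E] [TopologicalSpace H]
  {I : ModelWithCorners ℝ E H} {M : Type*} [TopologicalSpace M] [ChartedSpace H M]

/-- **Signed count of critical points, pointwise vs. by index**: for a finite critical set with
indices `< N`, `Σ_{x critical} (-1)^{ind x} = Σ_{k<N} (-1)^k #{critical points of index k}`
(the bookkeeping behind the Morse equality, Milnor 1963, Thm. 5.2). [cite: Milnor1963, Thm. 5.2] -/
theorem sum_neg_one_pow_morseIndex_eq {f : M → ℝ} (hC : (criticalSet I f).Finite) {N : ℕ}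
    (hN : ∀ x ∈ criticalSet I f, morseIndex I f x < N) :
    ∑ x ∈ hC.toFinset, (-1 : ℤ) ^ morseIndex I f x =
      ∑ k ∈ Finset.range N, (-1 : ℤ) ^ k * ((criticalSetOfIndex I f k).ncard : ℤ) := by
  classical
  have hfib : ∀ k, criticalSetOfIndex I f k =
      ↑(hC.toFinset.filter fun x => morseIndex I f x = k) := by
    intro k
    ext x
    simp [mem_criticalSetOfIndex]
  have hncard : ∀ k, ((criticalSetOfIndex I f k).ncard : ℤ) =
      ((hC.toFinset.filter fun x => morseIndex I f x = k).card : ℤ) := by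
    intro k
    rw [hfib k, Set.ncard_coe_finset]
  simp_rw [hncard]
  rw [← Finset.sum_fiberwise_of_maps_to (s := hC.toFinset) (t := Finset.range N)
    (g := fun x => morseIndex I f x) (f := fun x => (-1 : ℤ) ^ morseIndex I f x)
    (fun x hx => Finset.mem_range.2 (hN x (by simpa using hx)))]
  refine Finset.sum_congr rfl fun k _ => ?_
  rw [Finset.sum_congr rfl (g := fun _ => (-1 : ℤ) ^ k) fun x hx => by
    rw [(Finset.mem_filter.1 hx).2], Finset.sum_const, nsmul_eq_mul, mul_comm]

end Count

/-! ### The perturbation theorem -/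

section Main

/-- **Morse perturbation of `ℓ ∘ f` near a regular fibre over a nondegenerate critical point of
`ℓ`** (Milnor 1963, §2–§3 with Ehresmann's local triviality, Bröcker–Jänich 1982, (8.12)).
Let `f : X → B` be `C^∞` from a closed 4-manifold to a surface, submersive over the open
`O ∋ y₀`; `ℓ : B → ℝ` smooth with a nondegenerate critical point at `y₀`; `g : X → ℝ` smooth
with `g = ℓ ∘ f` over `O`; `e : S → X` a smooth embedding of a non-empty closed surface onto
the fibre `f⁻¹(y₀)`.  Then there are a compact `K ⊆ O` containing `y₀` and a `C^∞` function
`g̃ : X → ℝ` with the germ of `g` at every point not over `K`, all of whose critical points over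
`K` are nondegenerate, finitely many, with signed count
`Σ (-1)^{ind} = (-1)^{ind_{y₀} ℓ} · χ(S)` (`χ(S) = relEuler ℤ ℤ S ∅`, by the Morse equality on
the closed surface `S`, the tree's `SphereMorseCount.morseCount_eq_relEuler`): the critical
points over `K` are the critical points of a Morse function `μ` on the fibre, of index
`ind ℓ + ind μ`. [cite: Milnor1963, §3 and Thm. 5.2] [cite: BrockerJanichIDT1982, (8.12)] -/
theorem exists_morsePerturbation_near_regularFibre
    {X : Type*} [TopologicalSpace X] [T2Space X] [SecondCountableTopology X] [CompactSpace X]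
    [ChartedSpace (EuclideanSpace ℝ (Fin 4)) X] [IsManifold (𝓡 4) ∞ X]
    {B : Type*} [TopologicalSpace B] [T2Space B] [ChartedSpace (EuclideanSpace ℝ (Fin 2)) B]
    [IsManifold (𝓡 2) ∞ B]
    {f : X → B} (hf : ContMDiff (𝓡 4) (𝓡 2) ∞ f) {y₀ : B} {O : Set B} (hO : IsOpen O)
    (hy₀ : y₀ ∈ O) (hsub : ∀ x, f x ∈ O → Surjective (mfderiv (𝓡 4) (𝓡 2) f x))
    {ℓ : B → ℝ} (hℓ : ContMDiff (𝓡 2) 𝓘(ℝ, ℝ) ∞ ℓ) (hcrit : IsMCriticalPt (𝓡 2) ℓ y₀)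
    (hnd : (mhessian (𝓡 2) ℓ y₀).Nondegenerate)
    {g : X → ℝ} (hg : ContMDiff (𝓡 4) 𝓘(ℝ, ℝ) ∞ g) (hgℓ : ∀ x, f x ∈ O → g x = ℓ (f x))
    {S : Type*} [TopologicalSpace S] [T2Space S] [SecondCountableTopology S] [CompactSpace S]
    [Nonempty S] [ChartedSpace (EuclideanSpace ℝ (Fin 2)) S] [IsManifold (𝓡 2) ∞ S] {e : S → X}
    (he : Manifold.IsSmoothEmbedding (𝓡 2) (𝓡 4) ∞ e) (hrange : range e = f ⁻¹' {y₀}) :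
    ∃ (K : Set B) (g' : X → ℝ), IsCompact K ∧ K ⊆ O ∧ y₀ ∈ K ∧
      ContMDiff (𝓡 4) 𝓘(ℝ, ℝ) ∞ g' ∧
      (∀ x, f x ∉ K → g' =ᶠ[𝓝 x] g) ∧
      (∀ x, f x ∈ K → IsMCriticalPt (𝓡 4) g' x → (mhessian (𝓡 4) g' x).Nondegenerate) ∧
      ∃ C : Finset X, (∀ x, x ∈ C ↔ f x ∈ K ∧ IsMCriticalPt (𝓡 4) g' x) ∧
        ∑ x ∈ C, (-1 : ℤ) ^ morseIndex (𝓡 4) g' x =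
          (-1 : ℤ) ^ morseIndex (𝓡 2) ℓ y₀ *
            Literature.AlgebraicTopology.SingularHomology.relEuler ℤ ℤ S ∅ := by
  classical
  have hinj : Injective e := he.isEmbedding.injective
  have hfe : ∀ s, f (e s) = y₀ := fun s => by
    have : e s ∈ f ⁻¹' {y₀} := hrange ▸ mem_range_self s
    simpa using this
  obtain ⟨V, τ, β, Tr, Sr, h, hVO⟩ :=
    exists_isLocalProductNear hf hO hy₀ hsub (hfe (Classical.arbitrary S))
  -- a Morse function on the fibre surface
  obtain ⟨μ, hμ⟩ := exists_isMorse_holds 2 S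
  have hCfin : (criticalSet (𝓡 2) μ).Finite := IsMorse.finite_criticalSet_holds hμ
  -- `λ = ℓ ∘ β` has an isolated critical point at `0`
  obtain ⟨hbase₁, hbase₂⟩ := h.morseData_base hℓ
  have hlam_s : ContDiff ℝ ∞ (ℓ ∘ β) := contMDiff_iff_contDiff.1 (hℓ.comp h.contMDiff_β)
  have hlam0 : fderiv ℝ (ℓ ∘ β) 0 = 0 := hbase₁.1 hcrit
  have hlamnd : (mhessian (𝓡 2) (ℓ ∘ β) 0).Nondegenerate := (hbase₂ hcrit).1.1 hnd
  obtain ⟨δ, hδ, hδiso⟩ : ∃ δ > 0, ∀ u : EuclideanSpace ℝ (Fin 2), u ≠ 0 → ‖u‖ < δ →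
      fderiv ℝ (ℓ ∘ β) u ≠ 0 := by
    have hcm : ContMDiff (𝓡 2) 𝓘(ℝ, ℝ) 2 (ℓ ∘ β) := (hlam_s.of_le (by norm_cast)).contMDiff
    have hc0 : IsMCriticalPt (𝓡 2) (ℓ ∘ β) 0 := by
      unfold IsMCriticalPt
      rw [mfderiv_eq_fderiv]
      exact hlam0
    have hev := eventually_not_isMCriticalPt_of_nondegenerate (I := 𝓡 2) hcm le_rfl hc0 hlamnd
    rw [eventually_nhdsWithin_iff, Metric.eventually_nhds_iff] at hev
    obtain ⟨δ, hδ, H⟩ := hev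
    refine ⟨δ, hδ, fun u hu hud h0 => H (by simpa using hud) hu ?_⟩
    unfold IsMCriticalPt
    rw [mfderiv_eq_fderiv]
    exact h0
  -- the bump function: radii `ρ = δ / 3` and `2ρ`
  set ρ : ℝ := δ / 3 with hρdef
  have hρ : 0 < ρ := by positivity
  let χ : ContDiffBump (0 : EuclideanSpace ℝ (Fin 2)) := ⟨ρ, 2 * ρ, hρ, by linarith⟩
  have hrIn : χ.rIn = ρ := rfl
  have hrOut : χ.rOut = 2 * ρ := rfl
  have hχout : ∀ u, χ.rOut ≤ ‖u‖ → χ u = 0 := fun u hu =>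
    χ.zero_of_le_dist (by simpa using hu)
  have hisol : ∀ u, u ≠ 0 → ‖u‖ ≤ χ.rOut → fderiv ℝ (ℓ ∘ β) u ≠ 0 := fun u hu hur =>
    hδiso u hu (by rw [hrOut] at hur; linarith)
  -- bounds: `|μ| ≤ M`, `‖Dχ‖ ≤ Cχ` on the big ball, `‖Dλ‖ ≥ c` on the annulus
  obtain ⟨M, hM0, hM⟩ : ∃ M, 0 ≤ M ∧ ∀ s, |μ s| ≤ M := by
    obtain ⟨M, hM⟩ := isCompact_univ.exists_bound_of_continuousOn
      (hμ.contMDiff.continuous.continuousOn (s := univ))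
    exact ⟨max M 0, le_max_right _ _, fun s =>
      (le_max_left M 0).trans' (by simpa [Real.norm_eq_abs] using hM s (mem_univ s))⟩
  obtain ⟨Cχ, hCχ0, hCχ⟩ : ∃ C, 0 ≤ C ∧ ∀ u ∈ Metric.closedBall (0 : EuclideanSpace ℝ (Fin 2)) (2 * ρ),
      ‖fderiv ℝ χ u‖ ≤ C := by
    obtain ⟨C, hC⟩ := (isCompact_closedBall (0 : EuclideanSpace ℝ (Fin 2)) (2 * ρ)).exists_bound_of_continuousOn
      (((χ.contDiff (n := 1)).continuous_fderiv (by simp)).continuousOn)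
    exact ⟨max C 0, le_max_right _ _, fun u hu => (hC u hu).trans (le_max_left _ _)⟩
  set A : Set (EuclideanSpace ℝ (Fin 2)) := Metric.closedBall 0 (2 * ρ) ∩ {u | ρ ≤ ‖u‖} with hA
  have hAc : IsCompact A :=
    (isCompact_closedBall _ _).inter_right (isClosed_le continuous_const continuous_norm)
  have hApos : ∀ u ∈ A, fderiv ℝ (ℓ ∘ β) u ≠ 0 := fun u hu => by
    refine hisol u (fun h0 => ?_) (by rw [hrOut]; simpa using hu.1)
    have : ρ ≤ ‖u‖ := hu.2
    rw [h0, norm_zero] at this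
    exact absurd this (not_le.2 hρ)
  obtain ⟨C'', hC''1, hC''⟩ : ∃ C, 1 ≤ C ∧ ∀ u ∈ A, C⁻¹ ≤ ‖fderiv ℝ (ℓ ∘ β) u‖ := by
    have hcont : ContinuousOn (fun u => ‖fderiv ℝ (ℓ ∘ β) u‖⁻¹) A :=
      ((hlam_s.continuous_fderiv (by simp)).continuousOn.norm).inv₀
        fun u hu => norm_ne_zero_iff.2 (hApos u hu)
    obtain ⟨C, hC⟩ := hAc.exists_bound_of_continuousOn hcont
    refine ⟨max C 1, le_max_right _ _, fun u hu => ?_⟩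
    have hpos : 0 < ‖fderiv ℝ (ℓ ∘ β) u‖ := norm_pos_iff.2 (hApos u hu)
    have h1 : ‖fderiv ℝ (ℓ ∘ β) u‖⁻¹ ≤ max C 1 :=
      ((le_abs_self _).trans (by simpa [Real.norm_eq_abs] using hC u hu)).trans (le_max_left _ _)
    exact inv_le_of_inv_le₀ hpos h1
  have hC''pos : 0 < C'' := by linarith
  -- the size of the perturbation
  set ε : ℝ := C''⁻¹ / (2 * (M * Cχ + 1)) with hεdef
  have hε : 0 < ε := by positivity
  have hεsmall : ε * (M * Cχ) < C''⁻¹ := by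
    have hq : M * Cχ / (2 * (M * Cχ + 1)) < 1 := by
      rw [div_lt_one (by positivity)]
      nlinarith [mul_nonneg hM0 hCχ0]
    have : ε * (M * Cχ) = C''⁻¹ * (M * Cχ / (2 * (M * Cχ + 1))) := by
      rw [hεdef]; ring
    rw [this]
    exact mul_lt_of_lt_one_right (inv_pos.2 hC''pos) hq
  have hann : ∀ u, χ.rIn ≤ ‖u‖ → ‖u‖ ≤ χ.rOut → ∀ s : S,
      fderiv ℝ (ℓ ∘ β) u + (ε * μ s) • fderiv ℝ χ u ≠ 0 := by
    intro u hu1 hu2 s hsum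
    rw [hrIn] at hu1
    rw [hrOut] at hu2
    have huA : u ∈ A := ⟨by simpa using hu2, hu1⟩
    have heq : fderiv ℝ (ℓ ∘ β) u = -((ε * μ s) • fderiv ℝ χ u) := eq_neg_of_add_eq_zero_left hsum
    have hnorm : ‖fderiv ℝ (ℓ ∘ β) u‖ ≤ ε * (M * Cχ) := by
      rw [heq, norm_neg, norm_smul, Real.norm_eq_abs, abs_mul, abs_of_pos hε, mul_assoc]
      exact mul_le_mul_of_nonneg_left
        (mul_le_mul (hM s) (hCχ u (by simpa using hu2)) (norm_nonneg _) hM0) hε.le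
    linarith [hC'' u huA]
  -- the perturbed function and the compact `K`
  set g' := fibrePerturb f V τ Sr e g χ μ ε with hg'
  set K : Set B := β '' Metric.closedBall (0 : EuclideanSpace ℝ (Fin 2)) (2 * ρ) with hK
  have hKV : ∀ x, f x ∈ K → x ∈ f ⁻¹' V ∧ ‖τ (f x)‖ ≤ χ.rOut := by
    rintro x ⟨u, hu, hux⟩
    refine ⟨show f x ∈ V from hux ▸ h.β_mem u, ?_⟩
    rw [← hux, h.τ_β, hrOut]
    simpa using hu
  have key : ∀ x, f x ∈ K → _ := fun x hx =>
    h.morseData_fibrePerturb hf hVO hℓ hcrit hnd hgℓ he hrange hμ χ hε hisol hann (hKV x hx).1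
      (hKV x hx).2
  have heK : ∀ s, f (e s) ∈ K := fun s =>
    ⟨0, Metric.mem_closedBall_self (by positivity), by rw [hfe, h.β_zero]⟩
  have hcritE : ∀ s, IsMCriticalPt (𝓡 2) μ s → IsMCriticalPt (𝓡 4) g' (e s) := fun s hs =>
    (key _ (heK s)).1.2 ⟨by rw [hfe, h.τ_apply], by rwa [h.fibreCoord_apply_e hinj hrange s]⟩
  refine ⟨K, g', (isCompact_closedBall _ _).image h.contMDiff_β.continuous, ?_, ⟨0, ?_, h.β_zero⟩,
    h.contMDiff_fibrePerturb hf he hrange hg χ.contDiff hχout hμ.contMDiff ε,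
    fun x hx => h.fibrePerturb_eventuallyEq hf.continuous hχout hx,
    fun x hx hc => ((key x hx).2 hc).1, hCfin.toFinset.image e, fun x => ?_, ?_⟩
  · rintro _ ⟨u, -, rfl⟩
    exact hVO (h.β_mem u)
  · exact Metric.mem_closedBall_self (by positivity)
  · constructor
    · intro hx
      obtain ⟨s, hs, rfl⟩ := Finset.mem_image.1 hx
      have hsC : IsMCriticalPt (𝓡 2) μ s := by simpa using hs
      exact ⟨heK s, hcritE s hsC⟩
    · rintro ⟨hxK, hc⟩
      obtain ⟨h0, hμc⟩ := (key x hxK).1.1 hc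
      have hfx : f x = y₀ := h.eq_of_τ_eq_zero (hKV x hxK).1 h0
      obtain ⟨s, rfl⟩ : x ∈ range e := by
        rw [hrange]
        simpa using hfx
      rw [h.fibreCoord_apply_e hinj hrange s] at hμc
      exact Finset.mem_image.2 ⟨s, by simpa using hμc, rfl⟩
  · rw [Finset.sum_image fun s _ s' _ hss => hinj hss]
    have hterm : ∀ s ∈ hCfin.toFinset, (-1 : ℤ) ^ morseIndex (𝓡 4) g' (e s) =
        (-1) ^ morseIndex (𝓡 2) ℓ y₀ * (-1) ^ morseIndex (𝓡 2) μ s := by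
      intro s hs
      have hsC : IsMCriticalPt (𝓡 2) μ s := by simpa using hs
      obtain ⟨-, hind⟩ := (key _ (heK s)).2 (hcritE s hsC)
      rw [hind, h.fibreCoord_apply_e hinj hrange s, pow_add]
    rw [Finset.sum_congr rfl hterm, ← Finset.mul_sum]
    congr 1
    have hN : ∀ s ∈ criticalSet (𝓡 2) μ, morseIndex (𝓡 2) μ s < 3 := fun s _ => by
      have := morseIndex_le_finrank (𝓡 2) μ s
      rw [finrank_euclideanSpace_fin] at this
      omega
    rw [sum_neg_one_pow_morseIndex_eq hCfin hN, SphereMorseCount.morseCount_eq_relEuler (n := 1) hμ]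

end Main

end Literature.Topology.FourManifolds
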